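import Literature.Barriers.CriticalPhenomena.GridSAWFormulaCheckSound
import Literature.Combinatorics.SimpleGraph.GridFormulaCount
import HarnessLib

/-!
# The grid drawing of the graph of a formula, VI: the drawing and its validity

The named grid drawing `drawing ψ : SDrawing ℕ` of the graph `graphOf ψ`
(`Literature/Combinatorics/SimpleGraph/GridFormulaCount.lean`) — the embedding `E₀` of
Liśkiewicz–Ogihara–Toda 2003, proof of Theorem 7, for the grid-native gadget graph of Lemma 4 —
assembled from the stamps of `GridSAWFormulaStamps.lean`: the tile `(i, jj)` (`i ≤ V` the row,
row `V` the clause row; `jj = j + 1 ≤ N` the column, `jj = 0` the column of the doubling cell) is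
anchored at `anchor ψ i jj = (4V + 40 + 117·jj, 4V + 20 + 160·(V - i))`, the objects anchored
there are the kinds of the bundle of its parameters (`bspecAt`), every object contributes its own
vertices (named by `gname`: cell vertices `17·k + l`, gadget vertices `gbase g + idx`) at the
translated local positions and its edges with the translated rectilinear paths; the `V` return
paths joining the last cell of a row to the first connector of the next row are added around the
picture. Validity (`SDrawing.IsValid`) is assembled from the decided checks
(`GridSAWFormulaStampChecks.lean`, `GridSAWFormulaBundles.lean`) through their soundness
(`GridSAWFormulaCheckSound.lean`): the same object — `localOK`; two objects at near tiles — the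
realisability of actual neighbours (`realizable_of_mem`) gives `mayCooccur`, hence `compatB` and
`phantomOKB`; far objects — bounding boxes; return paths — arithmetic.

The identification of what is drawn with the abstract construction (`adj_iff_draws`,
`dverts_toFinset`) is the sibling file `GridSAWFormulaDrawingGraph.lean`.

## References

* M. Liśkiewicz, M. Ogihara, S. Toda, TCS 304 (2003) 129–156, §4 (proof of Theorem 7, `E₀`).
-/

namespace Literature.Barriers.CriticalPhenomena.GridSAW.FormulaDrawing

open Literature.Computability.Complexity (CNF)
open Literature.Combinatorics.SimpleGraph Literature.Combinatorics.SimpleGraph.GridFormula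
open Literature.Combinatorics.SimpleGraph.GridCell (conn vtx)

variable (ψ : CNF ℕ)

/-! ### Tile parameters read off the formula -/

/-- The tile kind at `(i, j)` as a `TK3`. [folklore] -/
def tk3 (i j : ℕ) : TK3 :=
  match tileTy ψ i j with
  | .empty => .e
  | .tap => .t
  | .cross => .c

/-- Column `j` lands on the top-middle slot of its terminal. [folklore] -/
def land3 (j : ℕ) : Bool := decide (landSlot ψ j = Slot.bN3)

/-- The role of the terminal of column `j`. [folklore] -/
def roleOf (j : ℕ) : Role :=
  if (ψ.getD (colClause ψ j) []).length = 1 then .or1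
  else match j - cstart ψ (colClause ψ j) with
    | 0 => .or3a
    | 1 => .or3b
    | _ => .or3c

/-- **The bundle parameters of tile `(i, jj)`.** [folklore] -/
def bspecAt (i jj : ℕ) : BSpec :=
  if jj = 0 then .doubler
  else if i < V ψ then
    .tile (tk3 ψ i (jj - 1)) (decide (2 ≤ jj)) (decide (jj < N ψ)) (if i = 0 then .e else tk3 ψ (i - 1) (jj - 1))
  else .clause (land3 ψ (jj - 1)) (tk3 ψ (V ψ - 1) (jj - 1)) (roleOf ψ (jj - 1)) (decide (jj < N ψ))

/-! ### Tiles and objects -/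

/-- The tile coordinates: the doubler's tile `(0, 0)`, the tile rows `i < V` and the clause row
`i = V`, columns `1 ≤ jj ≤ N`. [folklore] -/
def tcoords : List (ℕ × ℕ) :=
  (0, 0) :: (List.range (V ψ + 1)).flatMap fun i => (List.range (N ψ)).map fun j => (i, j + 1)

/-- Membership in `tcoords`. [folklore] -/
theorem mem_tcoords_iff {t : ℕ × ℕ} : t ∈ tcoords ψ ↔ t = (0, 0) ∨ (t.1 ≤ V ψ ∧ 1 ≤ t.2 ∧ t.2 ≤ N ψ) := by
  obtain ⟨i, jj⟩ := t
  simp only [tcoords, List.mem_cons, List.mem_flatMap, List.mem_range, List.mem_map, Prod.mk.injEq]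
  constructor
  · rintro (⟨rfl, rfl⟩ | ⟨i', hi', j, hj, rfl, rfl⟩)
    · exact Or.inl ⟨rfl, rfl⟩
    · exact Or.inr ⟨by omega, by omega, by omega⟩
  · rintro (⟨rfl, rfl⟩ | ⟨hi, hj, hj'⟩)
    · exact Or.inl ⟨rfl, rfl⟩
    · exact Or.inr ⟨i, by omega, jj - 1, by omega, rfl, by omega⟩

/-- **An object**: a kind anchored at a tile. [folklore] -/
abbrev Obj : Type := Kind × ℕ × ℕ

/-- **The objects of the drawing of `ψ`.** [folklore] -/
def objs : List Obj :=
  (tcoords ψ).flatMap fun t => (bspecAt ψ t.1 t.2).bundle.map fun κ => (κ, t.1, t.2)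

/-- Membership in `objs`. [folklore] -/
theorem mem_objs_iff {o : Obj} : o ∈ objs ψ ↔ (o.2.1, o.2.2) ∈ tcoords ψ ∧ o.1 ∈ (bspecAt ψ o.2.1 o.2.2).bundle := by
  obtain ⟨κ, i, jj⟩ := o
  simp only [objs, List.mem_flatMap, List.mem_map, Prod.mk.injEq]
  constructor
  · rintro ⟨⟨i', jj'⟩, ht, κ', hκ', rfl, rfl, rfl⟩
    exact ⟨ht, hκ'⟩
  · rintro ⟨ht, hκ⟩
    exact ⟨(i, jj), ht, κ, hκ, rfl, rfl, rfl⟩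

/-! ### Names of referenced vertices -/

/-- The cell index of the cell at position `c` of tile `(I, J)` (integer tile coordinates; junk
outside the picture). [folklore] -/
def cellAt (I J : ℤ) (c : ℕ) : ℕ :=
  if J ≤ 0 then 0
  else if I < V ψ then tileCell ψ I.toNat (J.toNat - 1) c
  else clauseBead ψ (J.toNat - 1)

/-- The gadget index of the gadget of family code `f` anchored at tile `(I, J)`. [folklore] -/
def gadAt (I J : ℤ) (f : ℕ) : ℕ :=
  if f ≤ 5 then 8 * (I.toNat * N ψ + (J.toNat - 1)) + f
  else if f = 6 then 8 * (V ψ * N ψ) + (J.toNat - 1)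
  else 8 * (V ψ * N ψ) + N ψ + colClause ψ (J.toNat - 1)

/-- **The global name of a referenced vertex** seen from tile `(i, jj)`: cell vertex `l` of cell
`k` is `17 k + l` (`l = 0` the connector `conn k`, `l = v + 1` the block vertex `vtx k v`); vertex
`idx` of gadget `g` is `gbase g + idx`. [folklore] -/
def gname (i jj : ℕ) : Ref → ℕ
  | .cell di dj c l => 17 * cellAt ψ (i + di) (jj + dj) c + l
  | .gad di dj f idx => gbase ψ (gadAt ψ (i + di) (jj + dj) f) + idx

/-- The name map of an object. [folklore] -/
def oname (o : Obj) : Ref → ℕ := gname ψ o.2.1 o.2.2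

/-! ### Positions -/

/-- **The anchor of tile `(i, jj)`.** [folklore] -/
def anchor (i jj : ℕ) : GridPoint :=
  ((4 * V ψ + 40 + 117 * jj : ℕ), (4 * V ψ + 20 + 160 * (V ψ - i) : ℕ))

/-- The anchor of an object. [folklore] -/
def oanchor (o : Obj) : GridPoint := anchor ψ o.2.1 o.2.2

/-- The list of (name, position) of all own vertices of all objects. [folklore] -/
def vposList : List (ℕ × GridPoint) :=
  (objs ψ).flatMap fun o => o.1.verts.map fun a => (oname ψ o a.1, shiftPt (oanchor ψ o) a.2)

/-- **The position of a vertex** (junk on names of no vertex). [folklore] -/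
def gpos (v : ℕ) : GridPoint := ((vposList ψ).lookup v).getD (0, 0)

/-! ### Edges -/

/-- **The drawn edges of an object**: names of the ends, translated rectilinear path. [folklore] -/
def oedges (o : Obj) : List (SEdge ℕ) :=
  o.1.wedges.map fun e => (oname ψ o e.1, oname ψ o e.2.1, (poly e.2.2).map (shiftPt (oanchor ψ o)))

/-- The east end of the return path of row `i`: the corner vertex `Q` of the last cell of the row.
[folklore] -/
def retStart (i : ℕ) : ℕ := 17 * tileCell ψ i (N ψ - 1) 2 + 4

/-- The west end of the return path of row `i`: the connector of the first cell of row `i + 1`.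
[folklore] -/
def retEnd (i : ℕ) : ℕ := 17 * (tileCell ψ i (N ψ - 1) 2 + 1)

/-- **The return path of row `i < V`**: east from `Q`, down outside the picture, west below it, up
on the left, east into the connector of the next row (nested: outer for smaller `i`). [folklore] -/
def retCorners (i : ℕ) : List GridPoint :=
  let a := anchor ψ i (N ψ)
  let b := anchor ψ (i + 1) 1
  let XR : ℤ := (4 * V ψ + 40 + 117 * (N ψ + 1) + 4 + 4 * (V ψ - i) : ℕ)
  let YB : ℤ := (2 + 4 * i : ℕ)
  let XL : ℤ := (2 + 4 * i : ℕ)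
  [(a.1 + 107, a.2), (XR, a.2), (XR, YB), (XL, YB), (XL, b.2), (b.1 + 15, b.2)]

/-- The return edges. [folklore] -/
def retEdges : List (SEdge ℕ) :=
  (List.range (V ψ)).map fun i => (retStart ψ i, retEnd ψ i, poly (retCorners ψ i))

/-! ### The drawing -/

/-- The own vertex names of an object. [folklore] -/
def overts (o : Obj) : List ℕ := o.1.ownKeys.map (oname ψ o)

/-- **The named grid drawing of the graph of `ψ`.** [cite: LiskiewiczOgiharaToda2003, §4 (proof of Theorem 7, the embedding E₀)] -/
def drawing : SDrawing ℕ where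
  verts := (objs ψ).flatMap (overts ψ)
  pos := gpos ψ
  edges := (objs ψ).flatMap (oedges ψ) ++ retEdges ψ

/-! ### Lookup of positions -/

/-- `List.lookup` finds the value of a listed key when the keys are distinct. [folklore] -/
theorem lookup_eq_of_nodup_keys {α β : Type} [BEq α] [LawfulBEq α] {l : List (α × β)}
    (h : (l.map Prod.fst).Nodup) {a : α} {b : β} (hab : (a, b) ∈ l) : l.lookup a = some b := by
  induction l with
  | nil => simp at hab
  | cons x l ih =>
    obtain ⟨x₁, x₂⟩ := x
    simp only [List.map_cons, List.nodup_cons, List.mem_map] at h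
    rcases List.mem_cons.1 hab with hx | hmem
    · simp only [Prod.mk.injEq] at hx
      obtain ⟨rfl, rfl⟩ := hx
      simp [List.lookup]
    · have hne : (a == x₁) = false := by
        rw [beq_eq_false_iff_ne]
        rintro rfl
        exact h.1 ⟨(a, b), hmem, rfl⟩
      simp only [List.lookup, hne]
      exact ih h.2 hmem

/-- Membership in `vposList`. [folklore] -/
theorem mem_vposList_iff {v : ℕ} {p : GridPoint} :
    (v, p) ∈ vposList ψ ↔ ∃ o ∈ objs ψ, ∃ a ∈ o.1.verts, oname ψ o a.1 = v ∧ shiftPt (oanchor ψ o) a.2 = p := by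
  simp only [vposList, List.mem_flatMap, List.mem_map, Prod.mk.injEq]

/-- **The position of an own vertex of an object** (given that names of own vertices are
globally distinct, `nodup_vposList_keys` below). [folklore] -/
theorem gpos_eq (hnd : ((vposList ψ).map Prod.fst).Nodup) {o : Obj} (ho : o ∈ objs ψ) {a : Ref × GridPoint}
    (ha : a ∈ o.1.verts) : gpos ψ (oname ψ o a.1) = shiftPt (oanchor ψ o) a.2 := by
  unfold gpos
  rw [lookup_eq_of_nodup_keys hnd ((mem_vposList_iff ψ).2 ⟨o, ho, a, ha, rfl, rfl⟩)]
  rfl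

/-! ### Facts about the tile parameters -/

variable {ψ}

/-- `tk3` is `c` exactly on crossings. [folklore] -/
theorem tk3_eq_c_iff {i j : ℕ} : tk3 ψ i j = .c ↔ tileTy ψ i j = .cross := by
  unfold tk3; cases tileTy ψ i j <;> simp

/-- `tk3` is `e` exactly on empty tiles. [folklore] -/
theorem tk3_eq_e_iff {i j : ℕ} : tk3 ψ i j = .e ↔ tileTy ψ i j = .empty := by
  unfold tk3; cases tileTy ψ i j <;> simp

/-- No crossing in the first row. [folklore] -/
theorem tk3_zero_ne_c (j : ℕ) : tk3 ψ 0 j ≠ .c := by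
  rw [ne_eq, tk3_eq_c_iff, tileTy_eq_cross_iff]; omega

/-- Above a crossing the tile is not empty. [folklore] -/
theorem tk3_ne_e_of_succ_c {i j : ℕ} (h : tk3 ψ (i + 1) j = .c) : tk3 ψ i j ≠ .e := by
  rw [tk3_eq_c_iff, tileTy_eq_cross_iff] at h
  rw [ne_eq, tk3_eq_e_iff]
  exact tileTy_ne_empty_of_le ψ (by omega)

/-- The last row of a column is not empty. [folklore] -/
theorem tk3_last_ne_e {j : ℕ} (hj : j < N ψ) : tk3 ψ (V ψ - 1) j ≠ .e := by
  rw [ne_eq, tk3_eq_e_iff]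
  exact tileTy_ne_empty_of_le ψ (by have := rowOf_varOf_lt ψ hj; omega)

/-- **Every column is a literal position of a clause.** [folklore] -/
theorem exists_cstart_add_of_lt {j : ℕ} (hj : j < N ψ) :
    ∃ q, ∃ hq : q < ψ.length, ∃ m, m < ψ[q].length ∧ j = cstart ψ q + m := by
  have key : ∀ n, n ≤ ψ.length → j < cstart ψ n → ∃ q, ∃ hq : q < ψ.length, ∃ m, m < ψ[q].length ∧ j = cstart ψ q + m := by
    intro n
    induction n with
    | zero => intro _ h; simp at h
    | succ n ih =>
      intro hn h
      rw [cstart_succ ψ (by omega)] at h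
      by_cases hlt : j < cstart ψ n
      · exact ih (by omega) hlt
      · exact ⟨n, by omega, j - cstart ψ n, by omega, by omega⟩
  exact key ψ.length le_rfl (by rw [cstart_length]; exact hj)

/-- Clauses of width one or three (the shape of Lemma 3's normal form that the layout uses).
[folklore] -/
def WidthOK (ψ : CNF ℕ) : Prop := ∀ q, ∀ hq : q < ψ.length, ψ[q].length = 1 ∨ ψ[q].length = 3

/-- **The role of a literal position** of a clause. [folklore] -/
theorem roleOf_cstart_add {q : ℕ} (hq : q < ψ.length) {m : ℕ} (hm : m < ψ[q].length) :
    roleOf ψ (cstart ψ q + m) =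
      if ψ[q].length = 1 then .or1 else (if m = 0 then .or3a else if m = 1 then .or3b else .or3c) := by
  unfold roleOf
  rw [colClause_cstart_add ψ hq hm, List.getD_eq_getElem _ _ hq, Nat.add_sub_cancel_left]
  split_ifs with h1 h2 h3
  · rfl
  · subst h2; rfl
  · subst h3; rfl
  · match m, h2, h3 with
    | k + 2, _, _ => rfl

/-- **Consecutive terminals have consecutive roles.** [folklore] -/
theorem succOK_roleOf (hw : WidthOK ψ) {j : ℕ} (hj : j + 1 < N ψ) : (roleOf ψ j).succOK (roleOf ψ (j + 1)) = true := by
  obtain ⟨q, hq, m, hm, rfl⟩ := exists_cstart_add_of_lt (show j < N ψ by omega)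
  rw [roleOf_cstart_add hq hm]
  by_cases hlast : m + 1 < ψ[q].length
  · rw [show cstart ψ q + m + 1 = cstart ψ q + (m + 1) by omega, roleOf_cstart_add hq hlast]
    rcases hw q hq with h | h <;> simp only [h] <;> split_ifs <;> first | decide | (exfalso; omega)
  · -- the next column starts clause `q + 1`
    have hq1 : q + 1 < ψ.length := by
      by_contra hge
      have : cstart ψ (q + 1) = N ψ := by
        rw [show q + 1 = ψ.length by omega, cstart_length]
      rw [cstart_succ ψ hq] at this; omega
    have hlen1 : 0 < ψ[q + 1].length := by
      rcases hw (q + 1) hq1 with h | h <;> omega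
    have heq : cstart ψ q + m + 1 = cstart ψ (q + 1) + 0 := by rw [cstart_succ ψ hq]; omega
    rw [heq, roleOf_cstart_add hq1 hlen1]
    rcases hw q hq with h | h <;> rcases hw (q + 1) hq1 with h' | h' <;> simp only [h, h'] <;> split_ifs <;>
      first | decide | (exfalso; omega)

/-- Two steps of roles. [folklore] -/
theorem succOK2_roleOf (hw : WidthOK ψ) {j : ℕ} (hj : j + 2 < N ψ) :
    (Role.all.any fun r => (roleOf ψ j).succOK r && r.succOK (roleOf ψ (j + 2))) = true := by
  rw [List.any_eq_true]
  exact ⟨roleOf ψ (j + 1), by unfold Role.all; cases roleOf ψ (j + 1) <;> simp,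
    by rw [Bool.and_eq_true]; exact ⟨succOK_roleOf hw (by omega), succOK_roleOf hw hj⟩⟩

/-- A head role sits at the start of its clause. [folklore] -/
theorem eq_cstart_of_roleOf_head {q : ℕ} (hq : q < ψ.length) {m : ℕ} (hm : m < ψ[q].length)
    (h : roleOf ψ (cstart ψ q + m) = .or1 ∨ roleOf ψ (cstart ψ q + m) = .or3a) (hw : WidthOK ψ) : m = 0 := by
  rw [roleOf_cstart_add hq hm] at h
  rcases hw q hq with h1 | h3
  · omega
  · simp only [h3, show (3 : ℕ) ≠ 1 by decide, ↓reduceIte] at h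
    split_ifs at h with h0 h1' <;> first | exact h0 | (rcases h with h | h <;> cases h)

/-- A head role of a three-literal clause leaves room for two more columns. [folklore] -/
theorem lt_N_of_roleOf_or3a (hw : WidthOK ψ) {j : ℕ} (hj : j < N ψ) (h : roleOf ψ j = .or3a) : j + 2 < N ψ := by
  obtain ⟨q, hq, m, hm, rfl⟩ := exists_cstart_add_of_lt hj
  have hm0 := eq_cstart_of_roleOf_head hq hm (Or.inr h) hw
  subst hm0
  rw [roleOf_cstart_add hq hm] at h
  rcases hw q hq with h1 | h3
  · simp [h1] at h
  · have := cstart_add_lt ψ hq (m := 2) (by omega); omega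

/-! ### Actual neighbours are realisable -/

/-- `bspecAt` of the doubler's tile. [folklore] -/
theorem bspecAt_zero_zero : bspecAt ψ 0 0 = .doubler := by simp [bspecAt]

/-- `bspecAt` of a tile-row tile. [folklore] -/
theorem bspecAt_tile {i jj : ℕ} (hi : i < V ψ) (hjj : 1 ≤ jj) :
    bspecAt ψ i jj = .tile (tk3 ψ i (jj - 1)) (decide (2 ≤ jj)) (decide (jj < N ψ)) (if i = 0 then .e else tk3 ψ (i - 1) (jj - 1)) := by
  unfold bspecAt; rw [if_neg (by omega), if_pos hi]

/-- `bspecAt` of a clause-row tile. [folklore] -/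
theorem bspecAt_clause {jj : ℕ} (hjj : 1 ≤ jj) :
    bspecAt ψ (V ψ) jj = .clause (land3 ψ (jj - 1)) (tk3 ψ (V ψ - 1) (jj - 1)) (roleOf ψ (jj - 1)) (decide (jj < N ψ)) := by
  unfold bspecAt; rw [if_neg (by omega), if_neg (lt_irrefl _)]

/-- Realisability of two clause-row tiles at a horizontal offset, from the role succession.
[folklore] -/
theorem realizable_clause_clause {l₁ l₂ e₁ e₂ : Bool} {ab₁ ab₂ : TK3} {r₁ r₂ : Role} {b : ℤ}
    (h0 : b = 0 → BSpec.clause l₁ ab₁ r₁ e₁ = .clause l₂ ab₂ r₂ e₂)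
    (h1 : b = 1 → e₁ = true ∧ r₁.succOK r₂ = true) (hm1 : b = -1 → e₂ = true ∧ r₂.succOK r₁ = true)
    (h2 : b = 2 → e₁ = true ∧ (Role.all.any fun r => r₁.succOK r && r.succOK r₂) = true)
    (hm2 : b = -2 → e₂ = true ∧ (Role.all.any fun r => r₂.succOK r && r.succOK r₁) = true)
    (hb : b ≤ 2 ∧ -2 ≤ b) :
    realizable (.clause l₁ ab₁ r₁ e₁) (.clause l₂ ab₂ r₂ e₂) (0, b) = true := by
  obtain ⟨hb1, hb2⟩ := hb
  interval_cases b
  · obtain ⟨he, h⟩ := hm2 rfl; subst he; simp [realizable, h]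
  · obtain ⟨he, h⟩ := hm1 rfl; subst he; simp [realizable, h]
  · have := h0 rfl; simp only [BSpec.clause.injEq] at this; obtain ⟨rfl, rfl, rfl, rfl⟩ := this; simp [realizable]
  · obtain ⟨he, h⟩ := h1 rfl; subst he; simp [realizable, h]
  · obtain ⟨he, h⟩ := h2 rfl; subst he; simp [realizable, h]

/-- **Two tiles of the picture at a near offset are realisable.** [folklore] -/
theorem realizable_bspecAt (hw : WidthOK ψ) {i₁ jj₁ i₂ jj₂ : ℕ} (h₁ : (i₁, jj₁) ∈ tcoords ψ) (h₂ : (i₂, jj₂) ∈ tcoords ψ)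
    {a b : ℤ} (ha : a = (i₂ : ℤ) - i₁) (hb : b = (jj₂ : ℤ) - jj₁)
    (hdi : a ≤ 1 ∧ -1 ≤ a) (hdj : b ≤ 2 ∧ -2 ≤ b) :
    realizable (bspecAt ψ i₁ jj₁) (bspecAt ψ i₂ jj₂) (a, b) = true := by
  rw [mem_tcoords_iff] at h₁ h₂
  simp only [Prod.mk.injEq] at h₁ h₂
  obtain ⟨ha1, ha2⟩ := hdi
  obtain ⟨hb1, hb2⟩ := hdj
  -- the classes of the two tiles
  have cls : ∀ {i jj : ℕ}, (i = 0 ∧ jj = 0) ∨ (i ≤ V ψ ∧ 1 ≤ jj ∧ jj ≤ N ψ) →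
      (i = 0 ∧ jj = 0 ∧ bspecAt ψ i jj = .doubler) ∨
      (i < V ψ ∧ 1 ≤ jj ∧ jj ≤ N ψ ∧ bspecAt ψ i jj =
        .tile (tk3 ψ i (jj - 1)) (decide (2 ≤ jj)) (decide (jj < N ψ)) (if i = 0 then .e else tk3 ψ (i - 1) (jj - 1))) ∨
      (i = V ψ ∧ 1 ≤ jj ∧ jj ≤ N ψ ∧ 0 < V ψ ∧ bspecAt ψ i jj =
        .clause (land3 ψ (jj - 1)) (tk3 ψ (V ψ - 1) (jj - 1)) (roleOf ψ (jj - 1)) (decide (jj < N ψ))) := by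
    rintro i jj (⟨rfl, rfl⟩ | ⟨hi, hj, hj'⟩)
    · exact Or.inl ⟨rfl, rfl, bspecAt_zero_zero⟩
    · rcases Nat.lt_or_ge i (V ψ) with hlt | hge
      · exact Or.inr (Or.inl ⟨hlt, hj, hj', bspecAt_tile hlt hj⟩)
      · have : i = V ψ := by omega
        subst this
        exact Or.inr (Or.inr ⟨rfl, hj, hj', V_pos_of_N_pos ψ (by omega), bspecAt_clause hj⟩)
  rcases cls h₁ with ⟨rfl, rfl, e₁⟩ | ⟨hi₁, hj₁, hj₁', e₁⟩ | ⟨hi₁, hj₁, hj₁', hV₁, e₁⟩ <;>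
    rcases cls h₂ with ⟨rfl, rfl, e₂⟩ | ⟨hi₂, hj₂, hj₂', e₂⟩ | ⟨hi₂, hj₂, hj₂', hV₂, e₂⟩
  -- clause / clause first (kept Boolean)
  case inr.inr.inr.inr =>
    subst hi₁; subst hi₂
    have ha' : a = 0 := by omega
    subst ha'
    rw [e₁, e₂]
    refine realizable_clause_clause (fun h => ?_) (fun h => ?_) (fun h => ?_) (fun h => ?_) (fun h => ?_) ⟨hb1, hb2⟩
    · have : jj₁ = jj₂ := by omega
      subst this; rfl
    · have : jj₂ = jj₁ + 1 := by omega
      subst this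
      refine ⟨decide_eq_true (by omega), ?_⟩
      have := succOK_roleOf hw (j := jj₁ - 1) (by omega)
      rwa [show jj₁ - 1 + 1 = jj₁ + 1 - 1 by omega] at this
    · have : jj₁ = jj₂ + 1 := by omega
      subst this
      refine ⟨decide_eq_true (by omega), ?_⟩
      have := succOK_roleOf hw (j := jj₂ - 1) (by omega)
      rwa [show jj₂ - 1 + 1 = jj₂ + 1 - 1 by omega] at this
    · have : jj₂ = jj₁ + 2 := by omega
      subst this
      refine ⟨decide_eq_true (by omega), ?_⟩
      have := succOK2_roleOf hw (j := jj₁ - 1) (by omega)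
      rwa [show jj₁ - 1 + 2 = jj₁ + 2 - 1 by omega] at this
    · have : jj₁ = jj₂ + 2 := by omega
      subst this
      refine ⟨decide_eq_true (by omega), ?_⟩
      have := succOK2_roleOf hw (j := jj₂ - 1) (by omega)
      rwa [show jj₂ - 1 + 2 = jj₂ + 2 - 1 by omega] at this
  all_goals (try rw [e₁]); all_goals (try rw [e₂])
  all_goals simp only [realizable, BSpec.east, BSpec.west, Bool.or_eq_true, Bool.and_eq_true, decide_eq_true_eq, Bool.not_eq_true',
      decide_eq_false_iff_not, Prod.mk.injEq, BSpec.tile.injEq, true_and]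
  -- doubler / doubler
  · omega
  -- doubler / tile
  · omega
  -- doubler / clause
  · omega
  -- tile / doubler
  · omega
  -- tile / tile
  · interval_cases a
    · -- a = -1 : the second is the row above
      by_cases hb0 : b = 0
      · subst hb0
        have hj : jj₁ = jj₂ := by omega
        subst hj
        have hi : i₁ = i₂ + 1 := by omega
        subst hi
        by_cases hc : tk3 ψ (i₂ + 1) (jj₁ - 1) = .c
        · have h2 := tk3_ne_e_of_succ_c hc
          simp [hc, h2]
        · simp [hc]
      · simp [hb0]
    · -- a = 0 : the same row
      have hi : i₁ = i₂ := by omega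
      subst hi
      interval_cases b
      · have : jj₁ = jj₂ + 2 := by omega
        subst this; simp; omega
      · have : jj₁ = jj₂ + 1 := by omega
        subst this; simp; omega
      · have : jj₁ = jj₂ := by omega
        subst this; simp
      · have : jj₂ = jj₁ + 1 := by omega
        subst this; simp; omega
      · have : jj₂ = jj₁ + 2 := by omega
        subst this; simp; omega
    · -- a = 1 : the second is the row below
      by_cases hb0 : b = 0
      · subst hb0
        have hj : jj₁ = jj₂ := by omega
        subst hj
        have hi : i₂ = i₁ + 1 := by omega
        subst hi
        by_cases hc : tk3 ψ (i₁ + 1) (jj₁ - 1) = .c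
        · have h2 := tk3_ne_e_of_succ_c hc
          simp [hc, h2]
        · simp [hc]
      · simp [hb0]
  -- tile / clause
  · have ha' : a = 1 := by omega
    subst ha'
    by_cases hb0 : b = 0
    · subst hb0
      have hj : jj₁ = jj₂ := by omega
      subst hj
      have hi : i₁ = V ψ - 1 := by omega
      subst hi
      simp [tk3_last_ne_e (show jj₁ - 1 < N ψ by omega)]
    · simp [hb0]
  -- clause / doubler
  · omega
  -- clause / tile
  · have ha' : a = -1 := by omega
    subst ha'
    by_cases hb0 : b = 0
    · subst hb0
      have hj : jj₁ = jj₂ := by omega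
      subst hj
      have hi : i₂ = V ψ - 1 := by omega
      subst hi
      simp [tk3_last_ne_e (show jj₁ - 1 < N ψ by omega)]
    · simp [hb0]
/-! ### Reading the decided checks -/

/-- Every kind is listed. [folklore] -/
theorem Kind.mem_all (κ : Kind) : κ ∈ Kind.all := by
  cases κ <;> decide

/-- Own references are admissible for their bundle. [folklore] -/
theorem keyOK_of_mem {b : BSpec} {κ : Kind} (hκ : κ ∈ b.bundle) {a : Ref × GridPoint} (ha : a ∈ κ.verts) :
    b.keyOK a.1 = true := by
  have := keyOK_bundle
  simp only [List.all_eq_true] at this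
  exact this b (BSpec.mem_all b) κ hκ a ha

/-- Foreign references sit at admissible offsets and are cell vertices. [folklore] -/
theorem offOK_of_mem {b : BSpec} {κ : Kind} (hκ : κ ∈ b.bundle) {a : Ref × GridPoint} (ha : a ∈ κ.phantoms) :
    b.offOK a.1.offset = true ∧ a.1.isCell = true := by
  have := offOK_bundle
  simp only [List.all_eq_true, Bool.and_eq_true] at this
  exact this b (BSpec.mem_all b) κ hκ a ha

/-- Different kinds of one bundle have no own reference in common. [folklore] -/
theorem eq_of_shared_key {b : BSpec} {κ₁ κ₂ : Kind} (h₁ : κ₁ ∈ b.bundle) (h₂ : κ₂ ∈ b.bundle)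
    {a₁ a₂ : Ref × GridPoint} (ha₁ : a₁ ∈ κ₁.verts) (ha₂ : a₂ ∈ κ₂.verts) (h : a₁.1 = a₂.1) : κ₁ = κ₂ := by
  have := ownKeys_disjoint_bundle
  simp only [List.all_eq_true, Bool.or_eq_true, decide_eq_true_eq] at this
  rcases this b (BSpec.mem_all b) κ₁ h₁ κ₂ h₂ with h' | h'
  · exact h'
  · exfalso
    have hmem : a₁.1 ∈ κ₂.verts.map Prod.fst := List.mem_map.2 ⟨a₂, ha₂, h.symm⟩
    have h'' := h' a₁ ha₁
    rw [Bool.not_eq_true', ← Bool.not_eq_true, List.contains_iff_mem] at h''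
    exact h'' hmem

/-- The bundle of any parameters lists each kind once. [folklore] -/
theorem nodup_bundle (b : BSpec) : b.bundle.Nodup := bundle_nodup b (BSpec.mem_all b)

/-- The filter from realisability, on the axis offsets. [folklore] -/
theorem mayCooccur_of_realizable_axis {b₁ b₂ : BSpec} {Δ : ℤ × ℤ} (hr : realizable b₁ b₂ Δ = true) (hΔ : Δ ∈ axisOffsets)
    {κ₁ κ₂ : Kind} (h₁ : κ₁ ∈ b₁.bundle) (h₂ : κ₂ ∈ b₂.bundle) (hne : κ₁ ≠ κ₂ ∨ Δ ≠ (0, 0)) :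
    mayCooccur κ₁ κ₂ Δ = true := by
  have := mayCooccur_axis
  simp only [List.all_eq_true, Bool.or_eq_true, Bool.not_eq_true', Bool.and_eq_true, decide_eq_true_eq] at this
  rcases this b₁ (BSpec.mem_all _) b₂ (BSpec.mem_all _) Δ hΔ with h | h
  · rw [h] at hr; exact absurd hr Bool.false_ne_true
  · rcases h κ₁ h₁ κ₂ h₂ with ⟨rfl, rfl⟩ | h'
    · simp at hne
    · exact h'

/-- The filter off the axes. [folklore] -/
theorem mayCooccur_of_offAxis {κ₁ κ₂ : Kind} {Δ : ℤ × ℤ} (hΔ : Δ ∈ offAxisOffsets)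
    (hr1 : Δ.1 = 1 → κ₁.rowClass = .tile) (hr2 : Δ.1 = -1 → κ₂.rowClass = .tile) : mayCooccur κ₁ κ₂ Δ = true := by
  have := mayCooccur_offAxis
  simp only [List.all_eq_true, Bool.or_eq_true, Bool.and_eq_true, decide_eq_true_eq, Bool.not_eq_true',
    decide_eq_false_iff_not] at this
  rcases this κ₁ (Kind.mem_all _) κ₂ (Kind.mem_all _) Δ hΔ with (⟨h, h'⟩ | ⟨h, h'⟩) | h
  · exact absurd (hr1 h) h'
  · exact absurd (hr2 h) h'
  · exact h

/-- Compatibility from the filter. [folklore] -/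
theorem compatB_of_mayCooccur {κ₁ κ₂ : Kind} {Δ : ℤ × ℤ} (hm : mayCooccur κ₁ κ₂ Δ = true) (hΔ : Δ ∈ nearOffsets)
    (hne : κ₁ ≠ κ₂ ∨ Δ ≠ (0, 0)) : Kind.compatB κ₁ κ₂ Δ = true := by
  have := compat_all κ₁
  simp only [List.all_eq_true, Bool.or_eq_true, Bool.and_eq_true, decide_eq_true_eq, Bool.not_eq_true'] at this
  rcases this κ₂ (Kind.mem_all _) Δ hΔ with (⟨rfl, rfl⟩ | h) | h
  · simp at hne
  · rw [h] at hm; exact absurd hm Bool.false_ne_true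
  · exact h

/-- Agreement of foreign end points from the filter. [folklore] -/
theorem phantomOKB_of_mayCooccur {κ₁ κ₂ : Kind} {Δ : ℤ × ℤ} (hm : mayCooccur κ₁ κ₂ Δ = true) (hΔ : Δ ∈ nearOffsets) :
    Kind.phantomOKB κ₁ κ₂ Δ = true := by
  have := phantomOK_all κ₁
  simp only [List.all_eq_true, Bool.or_eq_true, Bool.not_eq_true'] at this
  rcases this κ₂ (Kind.mem_all _) Δ hΔ with h | h
  · rw [h] at hm; exact absurd hm Bool.false_ne_true
  · exact h

/-- Resolution of foreign references from realisability. [folklore] -/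
theorem resolve_of_realizable {b₁ b₂ : BSpec} {Δ : ℤ × ℤ} (hr : realizable b₁ b₂ Δ = true) (hΔ : Δ ∈ axisOffsets)
    {κ₂ : Kind} (h₂ : κ₂ ∈ b₂.bundle) {q : Ref × GridPoint} (hq : q ∈ κ₂.phantoms) (hoff : q.1.offset = (-Δ.1, -Δ.2)) :
    ∃ κ₁ ∈ b₁.bundle, ∃ a ∈ κ₁.verts, a.1 = Kind.reRef Δ q.1 := by
  have := phantoms_resolve_bundle
  simp only [List.all_eq_true, Bool.or_eq_true, Bool.not_eq_true', decide_eq_false_iff_not, List.any_eq_true,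
    List.contains_iff_mem, List.mem_map] at this
  rcases this b₁ (BSpec.mem_all _) b₂ (BSpec.mem_all _) Δ hΔ with h | h
  · rw [h] at hr; exact absurd hr Bool.false_ne_true
  · rcases h κ₂ h₂ q hq with h' | ⟨κ₁, hκ₁, a, ha, hak⟩
    · exact absurd hoff h'
    · exact ⟨κ₁, hκ₁, a, ha, hak⟩

/-- The table facts of a kind. [folklore] -/
theorem tableOK_iff (κ : Kind) : κ.tableOK = true ↔
    (∀ a ∈ κ.verts, a.1.offset = (0, 0) ∧
      (match a.1 with | .cell _ _ c l => c ≤ 2 ∧ l ≤ 16 | .gad _ _ f idx => f ≤ 7 ∧ idx < 64)) ∧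
    ((κ.posTable).map Prod.fst).Nodup ∧
    (∀ a ∈ κ.phantoms, a.1.isCell = true ∧ a.1.offset ∈ [(0, 0), (0, -1), (-1, 0), (0, 1), (0, 2)] ∧
      (match a.1 with | .cell _ _ c l => c ≤ 2 ∧ l ≤ 16 | .gad .. => False)) ∧
    (∀ p ∈ (κ.posTable).map Prod.snd ++ κ.wedges.flatMap (fun e => e.2.2), inBoxB (-10) 257 (-27) 160 p = true) := by
  unfold Kind.tableOK
  simp only [Bool.and_eq_true, List.all_eq_true, decide_eq_true_eq]
  constructor
  · rintro ⟨⟨⟨h1, h2⟩, h3⟩, h4⟩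
    refine ⟨fun a ha => ⟨(h1 a ha).1, ?_⟩, h2, fun a ha => ⟨(h3 a ha).1.1, (h3 a ha).1.2, ?_⟩, h4⟩
    · have := (h1 a ha).2
      obtain ⟨r, p⟩ := a
      cases r <;> simpa using this
    · have := (h3 a ha).2
      obtain ⟨r, p⟩ := a
      cases r
      · simpa using this
      · simp at this
  · rintro ⟨h1, h2, h3, h4⟩
    refine ⟨⟨⟨fun a ha => ⟨(h1 a ha).1, ?_⟩, h2⟩, fun a ha => ⟨⟨(h3 a ha).1, (h3 a ha).2.1⟩, ?_⟩⟩, h4⟩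
    · have := (h1 a ha).2
      obtain ⟨r, p⟩ := a
      cases r <;> simpa using this
    · have := (h3 a ha).2.2
      obtain ⟨r, p⟩ := a
      cases r
      · simpa using this
      · simp at this

/-- Own references carry offset `0` and small indices. [folklore] -/
theorem own_offset {κ : Kind} {a : Ref × GridPoint} (ha : a ∈ κ.verts) :
    a.1.offset = (0, 0) ∧ (match a.1 with | .cell _ _ c l => c ≤ 2 ∧ l ≤ 16 | .gad _ _ f idx => f ≤ 7 ∧ idx < 64) :=
  ((tableOK_iff κ).1 (tables_ok κ)).1 a ha

/-- Foreign references are cell vertices with small indices. [folklore] -/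
theorem phantom_small {κ : Kind} {a : Ref × GridPoint} (ha : a ∈ κ.phantoms) :
    match a.1 with | .cell _ _ c l => c ≤ 2 ∧ l ≤ 16 | .gad .. => False :=
  (((tableOK_iff κ).1 (tables_ok κ)).2.2.1 a ha).2.2

/-- Listed references of a kind are pairwise distinct. [folklore] -/
theorem nodup_posTable_keys (κ : Kind) : ((κ.posTable).map Prod.fst).Nodup :=
  ((tableOK_iff κ).1 (tables_ok κ)).2.1

/-- Own references of a kind are pairwise distinct. [folklore] -/
theorem nodup_verts_keys (κ : Kind) : (κ.verts.map Prod.fst).Nodup := by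
  have := nodup_posTable_keys κ
  rw [Kind.posTable, List.map_append] at this
  exact this.of_append_left

/-- The local position of an own reference. [folklore] -/
theorem lpos_of_mem_verts {κ : Kind} {a : Ref × GridPoint} (ha : a ∈ κ.verts) : κ.lpos a.1 = a.2 := by
  unfold Kind.lpos
  rw [lookup_eq_of_nodup_keys (nodup_posTable_keys κ) (by rw [Kind.posTable]; exact List.mem_append_left _ ha)]
  rfl

/-- The local position of a foreign reference. [folklore] -/
theorem lpos_of_mem_phantoms {κ : Kind} {a : Ref × GridPoint} (ha : a ∈ κ.phantoms) : κ.lpos a.1 = a.2 := by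
  unfold Kind.lpos
  rw [lookup_eq_of_nodup_keys (nodup_posTable_keys κ) (by rw [Kind.posTable]; exact List.mem_append_right _ ha)]
  rfl

/-- Local coordinates lie in the box `[-10, 257] × [-27, 160]`. [folklore] -/
theorem inBox_local {κ : Kind} {p : GridPoint}
    (hp : p ∈ (κ.posTable).map Prod.snd ++ κ.wedges.flatMap fun e => e.2.2) : inBoxB (-10) 257 (-27) 160 p = true :=
  ((tableOK_iff κ).1 (tables_ok κ)).2.2.2 p hp

/-! ### The classes of tiles and the values of names -/

/-- The three classes of tiles of the picture, with their parameters. [folklore] -/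
theorem tile_classes {i jj : ℕ} (h : (i, jj) ∈ tcoords ψ) :
    (i = 0 ∧ jj = 0 ∧ bspecAt ψ i jj = .doubler) ∨
    (i < V ψ ∧ 1 ≤ jj ∧ jj ≤ N ψ ∧ bspecAt ψ i jj =
      .tile (tk3 ψ i (jj - 1)) (decide (2 ≤ jj)) (decide (jj < N ψ)) (if i = 0 then .e else tk3 ψ (i - 1) (jj - 1))) ∨
    (i = V ψ ∧ 1 ≤ jj ∧ jj ≤ N ψ ∧ 0 < V ψ ∧ bspecAt ψ i jj =
      .clause (land3 ψ (jj - 1)) (tk3 ψ (V ψ - 1) (jj - 1)) (roleOf ψ (jj - 1)) (decide (jj < N ψ))) := by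
  rw [mem_tcoords_iff] at h
  rcases h with h | ⟨hi, hj, hj'⟩
  · simp only [Prod.mk.injEq] at h; obtain ⟨rfl, rfl⟩ := h
    exact Or.inl ⟨rfl, rfl, bspecAt_zero_zero⟩
  · simp only at hi hj hj'
    rcases Nat.lt_or_ge i (V ψ) with hlt | hge
    · exact Or.inr (Or.inl ⟨hlt, hj, hj', bspecAt_tile hlt hj⟩)
    · have : i = V ψ := by omega
      subst this
      exact Or.inr (Or.inr ⟨rfl, hj, hj', V_pos_of_N_pos ψ (by omega), bspecAt_clause hj⟩)

/-- `cellAt` on natural coordinates. [folklore] -/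
theorem cellAt_nat (i jj c : ℕ) :
    cellAt ψ i jj c = if jj = 0 then 0 else if i < V ψ then tileCell ψ i (jj - 1) c else clauseBead ψ (jj - 1) := by
  unfold cellAt
  simp only [Int.toNat_natCast, Nat.cast_lt]
  by_cases h : jj = 0
  · simp [h]
  · rw [if_neg (by omega), if_neg h]

/-- `gadAt` on natural coordinates. [folklore] -/
theorem gadAt_nat (i jj f : ℕ) :
    gadAt ψ i jj f = if f ≤ 5 then 8 * (i * N ψ + (jj - 1)) + f
      else if f = 6 then 8 * (V ψ * N ψ) + (jj - 1) else 8 * (V ψ * N ψ) + N ψ + colClause ψ (jj - 1) := by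
  unfold gadAt; simp only [Int.toNat_natCast]

/-- The name of an own cell reference. [folklore] -/
theorem gname_cell00 (i jj c l : ℕ) : gname ψ i jj (.cell 0 0 c l) = 17 * cellAt ψ i jj c + l := by
  simp [gname]

/-- The name of an own gadget reference. [folklore] -/
theorem gname_gad00 (i jj f idx : ℕ) : gname ψ i jj (.gad 0 0 f idx) = gbase ψ (gadAt ψ i jj f) + idx := by
  simp [gname]

/-- Cell indices of the picture are below `ncells`. [folklore] -/
theorem cellAt_lt_ncells {i jj c : ℕ} (h : (i, jj) ∈ tcoords ψ) (hc : c ≤ 2) : cellAt ψ i jj c < ncells ψ := by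
  rw [cellAt_nat]
  rcases tile_classes h with ⟨rfl, rfl, -⟩ | ⟨hi, hj, hj', -⟩ | ⟨hi, hj, hj', -, -⟩
  · simp [ncells]
  · rw [if_neg (by omega), if_pos hi]; exact tileCell_lt_ncells ψ hi (by omega) (by omega)
  · subst hi; rw [if_neg (by omega), if_neg (lt_irrefl _)]; exact clauseBead_lt_ncells ψ (by omega)

/-! ### Names of own vertices are injective -/

/-- An own reference with its constructor data and the class constraints of its bundle.
[folklore] -/
theorem own_key_cases {o : Obj} (ho : o ∈ objs ψ) {a : Ref × GridPoint} (ha : a ∈ o.1.verts) :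
    (∃ c l, a.1 = .cell 0 0 c l ∧ c ≤ 2 ∧ l ≤ 16 ∧ (bspecAt ψ o.2.1 o.2.2 = .doubler → c = 2) ∧
        (∀ l' ab r e, bspecAt ψ o.2.1 o.2.2 = .clause l' ab r e → c = 0)) ∨
    (∃ f idx, a.1 = .gad 0 0 f idx ∧ idx < 64 ∧ bspecAt ψ o.2.1 o.2.2 ≠ .doubler ∧
        (∀ tk w e ab, bspecAt ψ o.2.1 o.2.2 = .tile tk w e ab → f ≤ 5) ∧
        (∀ l' ab r e, bspecAt ψ o.2.1 o.2.2 = .clause l' ab r e → f = 6 ∨ (f = 7 ∧ (r = .or1 ∨ r = .or3a)))) := by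
  have hk := keyOK_of_mem ((mem_objs_iff ψ).1 ho).2 ha
  obtain ⟨hoff, hsmall⟩ := own_offset ha
  obtain ⟨r, p⟩ := a
  cases r with
  | cell di dj c l =>
    simp only [Ref.offset, Prod.mk.injEq] at hoff
    obtain ⟨rfl, rfl⟩ := hoff
    simp only at hsmall
    refine Or.inl ⟨c, l, rfl, hsmall.1, hsmall.2, fun hd => ?_, fun l' ab r e hc => ?_⟩
    · rw [hd] at hk; simpa [BSpec.keyOK] using hk
    · rw [hc] at hk; simpa [BSpec.keyOK] using hk
  | gad di dj f idx =>
    simp only [Ref.offset, Prod.mk.injEq] at hoff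
    obtain ⟨rfl, rfl⟩ := hoff
    simp only at hsmall
    refine Or.inr ⟨f, idx, rfl, hsmall.2, fun hd => ?_, fun tk w e ab ht => ?_, fun l' ab r e hc => ?_⟩
    · rw [hd] at hk; simp [BSpec.keyOK] at hk
    · rw [ht] at hk; simpa [BSpec.keyOK] using hk
    · rw [hc] at hk; simpa [BSpec.keyOK] using hk

/-- Columns of head terminals are determined by their clause. [folklore] -/
theorem col_eq_of_head (hw : WidthOK ψ) {j₁ j₂ : ℕ} (hj₁ : j₁ < N ψ) (hj₂ : j₂ < N ψ)
    (h₁ : roleOf ψ j₁ = .or1 ∨ roleOf ψ j₁ = .or3a) (h₂ : roleOf ψ j₂ = .or1 ∨ roleOf ψ j₂ = .or3a)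
    (h : colClause ψ j₁ = colClause ψ j₂) : j₁ = j₂ := by
  obtain ⟨q₁, hq₁, m₁, hm₁, rfl⟩ := exists_cstart_add_of_lt hj₁
  obtain ⟨q₂, hq₂, m₂, hm₂, rfl⟩ := exists_cstart_add_of_lt hj₂
  have e₁ := eq_cstart_of_roleOf_head hq₁ hm₁ h₁ hw
  have e₂ := eq_cstart_of_roleOf_head hq₂ hm₂ h₂ hw
  subst e₁; subst e₂
  rw [colClause_cstart_add ψ hq₁ hm₁, colClause_cstart_add ψ hq₂ hm₂] at h
  subst h; rfl

/-- **Names of own vertices are globally injective**: the name determines the object and the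
reference. [folklore] -/
theorem oname_inj (hw : WidthOK ψ) {o₁ o₂ : Obj} (h₁ : o₁ ∈ objs ψ) (h₂ : o₂ ∈ objs ψ) {a₁ a₂ : Ref × GridPoint}
    (ha₁ : a₁ ∈ o₁.1.verts) (ha₂ : a₂ ∈ o₂.1.verts) (h : oname ψ o₁ a₁.1 = oname ψ o₂ a₂.1) :
    o₁ = o₂ ∧ a₁.1 = a₂.1 := by
  obtain ⟨κ₁, i₁, jj₁⟩ := o₁
  obtain ⟨κ₂, i₂, jj₂⟩ := o₂
  obtain ⟨ht₁, hb₁⟩ := (mem_objs_iff ψ).1 h₁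
  obtain ⟨ht₂, hb₂⟩ := (mem_objs_iff ψ).1 h₂
  simp only at ht₁ ht₂ hb₁ hb₂
  -- it suffices to identify the tiles and the references
  suffices key : (i₁, jj₁) = (i₂, jj₂) ∧ a₁.1 = a₂.1 by
    obtain ⟨ht, hr⟩ := key
    simp only [Prod.mk.injEq] at ht
    obtain ⟨rfl, rfl⟩ := ht
    exact ⟨by rw [eq_of_shared_key hb₁ hb₂ ha₁ ha₂ hr], hr⟩
  have hnc : 0 < ncells ψ := by unfold ncells; omega
  rcases own_key_cases h₁ ha₁ with ⟨c₁, l₁, e₁, hc₁, hl₁, hd₁, hk₁⟩ | ⟨f₁, x₁, e₁, hx₁, hd₁, htile₁, hcl₁⟩ <;>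
    rcases own_key_cases h₂ ha₂ with ⟨c₂, l₂, e₂, hc₂, hl₂, hd₂, hk₂⟩ | ⟨f₂, x₂, e₂, hx₂, hd₂, htile₂, hcl₂⟩ <;>
    simp only [oname, e₁, e₂, gname_cell00, gname_gad00] at h ⊢
  · -- cell / cell
    have hlt₁ := cellAt_lt_ncells ht₁ hc₁
    have hlt₂ := cellAt_lt_ncells ht₂ hc₂
    have hk : cellAt ψ i₁ jj₁ c₁ = cellAt ψ i₂ jj₂ c₂ ∧ l₁ = l₂ := by omega
    obtain ⟨hk, rfl⟩ := hk
    rw [cellAt_nat, cellAt_nat] at hk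
    rcases tile_classes ht₁ with ⟨rfl, rfl, hb₁'⟩ | ⟨hi₁, hj₁, hj₁', hb₁'⟩ | ⟨hi₁, hj₁, hj₁', hV₁, hb₁'⟩ <;>
      rcases tile_classes ht₂ with ⟨rfl, rfl, hb₂'⟩ | ⟨hi₂, hj₂, hj₂', hb₂'⟩ | ⟨hi₂, hj₂, hj₂', hV₂, hb₂'⟩
    · exact ⟨rfl, by rw [hd₁ hb₁', hd₂ hb₂']⟩
    · rw [if_pos rfl, if_neg (by omega), if_pos hi₂] at hk
      have := tileCell_pos ψ i₂ (jj₂ - 1) c₂; omega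
    · subst hi₂; rw [if_pos rfl, if_neg (by omega), if_neg (lt_irrefl _)] at hk
      unfold clauseBead at hk; omega
    · rw [if_neg (by omega), if_pos hi₁, if_pos rfl] at hk
      have := tileCell_pos ψ i₁ (jj₁ - 1) c₁; omega
    · rw [if_neg (by omega), if_pos hi₁, if_neg (by omega), if_pos hi₂] at hk
      obtain ⟨rfl, hj, rfl⟩ := tileCell_inj ψ (by omega) (by omega) (by omega) (by omega) hk
      exact ⟨Prod.ext rfl (by simp only; omega), rfl⟩
    · subst hi₂
      rw [if_neg (by omega), if_pos hi₁, if_neg (by omega), if_neg (lt_irrefl _)] at hk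
      exact absurd hk (tileCell_ne_clauseBead ψ hi₁ (by omega) (by omega) _)
    · subst hi₁; rw [if_neg (by omega), if_neg (lt_irrefl _), if_pos rfl] at hk
      unfold clauseBead at hk; omega
    · subst hi₁
      rw [if_neg (by omega), if_neg (lt_irrefl _), if_neg (by omega), if_pos hi₂] at hk
      exact absurd hk.symm (tileCell_ne_clauseBead ψ hi₂ (by omega) (by omega) _)
    · subst hi₁; subst hi₂
      rw [if_neg (by omega), if_neg (lt_irrefl _), if_neg (by omega), if_neg (lt_irrefl _)] at hk
      unfold clauseBead at hk
      have hj : jj₁ = jj₂ := by omega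
      subst hj
      exact ⟨rfl, by rw [hk₁ _ _ _ _ hb₁', hk₂ _ _ _ _ hb₂']⟩
  · -- cell / gad : impossible by size
    exfalso
    have hlt₁ := cellAt_lt_ncells ht₁ hc₁
    unfold gbase at h
    have : 17 * cellAt ψ i₁ jj₁ c₁ + l₁ < 17 * ncells ψ := by nlinarith
    omega
  · exfalso
    have hlt₂ := cellAt_lt_ncells ht₂ hc₂
    unfold gbase at h
    have : 17 * cellAt ψ i₂ jj₂ c₂ + l₂ < 17 * ncells ψ := by nlinarith
    omega
  · -- gad / gad
    unfold gbase at h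
    have hg : gadAt ψ i₁ jj₁ f₁ = gadAt ψ i₂ jj₂ f₂ ∧ x₁ = x₂ := by omega
    obtain ⟨hg, rfl⟩ := hg
    rw [gadAt_nat, gadAt_nat] at hg
    rcases tile_classes ht₁ with ⟨rfl, rfl, hb₁'⟩ | ⟨hi₁, hj₁, hj₁', hb₁'⟩ | ⟨hi₁, hj₁, hj₁', hV₁, hb₁'⟩
    · exact absurd hb₁' hd₁
    rotate_left
    · -- clause / ?
      subst hi₁
      rcases tile_classes ht₂ with ⟨rfl, rfl, hb₂'⟩ | ⟨hi₂, hj₂, hj₂', hb₂'⟩ | ⟨hi₂, hj₂, hj₂', hV₂, hb₂'⟩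
      · exact absurd hb₂' hd₂
      · -- clause / tile : sizes differ
        exfalso
        have hf₂ := htile₂ _ _ _ _ hb₂'
        rcases hcl₁ _ _ _ _ hb₁' with rfl | ⟨rfl, -⟩
        · rw [if_neg (by omega), if_pos rfl, if_pos hf₂] at hg
          have : i₂ * N ψ + (jj₂ - 1) < V ψ * N ψ := by
            calc i₂ * N ψ + (jj₂ - 1) < i₂ * N ψ + N ψ := by omega
              _ = (i₂ + 1) * N ψ := by ring
              _ ≤ V ψ * N ψ := Nat.mul_le_mul_right _ hi₂
          omega
        · rw [if_neg (by omega), if_neg (by omega), if_pos hf₂] at hg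
          have : i₂ * N ψ + (jj₂ - 1) < V ψ * N ψ := by
            calc i₂ * N ψ + (jj₂ - 1) < i₂ * N ψ + N ψ := by omega
              _ = (i₂ + 1) * N ψ := by ring
              _ ≤ V ψ * N ψ := Nat.mul_le_mul_right _ hi₂
          omega
      · -- clause / clause
        subst hi₂
        rcases hcl₁ _ _ _ _ hb₁' with rfl | ⟨rfl, hr₁⟩ <;> rcases hcl₂ _ _ _ _ hb₂' with rfl | ⟨rfl, hr₂⟩
        · rw [if_neg (by omega), if_pos rfl, if_neg (by omega), if_pos rfl] at hg
          have : jj₁ = jj₂ := by omega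
          subst this; exact ⟨rfl, rfl⟩
        · rw [if_neg (by omega), if_pos rfl, if_neg (by omega), if_neg (by omega)] at hg; omega
        · rw [if_neg (by omega), if_neg (by omega), if_neg (by omega), if_pos rfl] at hg; omega
        · rw [if_neg (by omega), if_neg (by omega), if_neg (by omega), if_neg (by omega)] at hg
          have hcc : colClause ψ (jj₁ - 1) = colClause ψ (jj₂ - 1) := by omega
          have := col_eq_of_head hw (by omega) (by omega) hr₁ hr₂ hcc
          have hj : jj₁ = jj₂ := by omega
          subst hj; exact ⟨rfl, rfl⟩
    · -- tile / ?
      have hf₁ := htile₁ _ _ _ _ hb₁'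
      rcases tile_classes ht₂ with ⟨rfl, rfl, hb₂'⟩ | ⟨hi₂, hj₂, hj₂', hb₂'⟩ | ⟨hi₂, hj₂, hj₂', hV₂, hb₂'⟩
      · exact absurd hb₂' hd₂
      · -- tile / tile
        have hf₂ := htile₂ _ _ _ _ hb₂'
        rw [if_pos hf₁, if_pos hf₂] at hg
        have ht : i₁ * N ψ + (jj₁ - 1) = i₂ * N ψ + (jj₂ - 1) ∧ f₁ = f₂ := by omega
        obtain ⟨ht, rfl⟩ := ht
        have hN : 0 < N ψ := by omega
        have hi : i₁ = i₂ := by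
          have h1 : (i₁ * N ψ + (jj₁ - 1)) / N ψ = i₁ := by
            rw [Nat.add_div hN, Nat.mul_div_cancel _ hN, Nat.div_eq_of_lt (show jj₁ - 1 < N ψ by omega)]
            simp [Nat.mod_eq_of_lt (show jj₁ - 1 < N ψ by omega), not_le.2 (show jj₁ - 1 < N ψ by omega)]
          have h2 : (i₂ * N ψ + (jj₂ - 1)) / N ψ = i₂ := by
            rw [Nat.add_div hN, Nat.mul_div_cancel _ hN, Nat.div_eq_of_lt (show jj₂ - 1 < N ψ by omega)]
            simp [Nat.mod_eq_of_lt (show jj₂ - 1 < N ψ by omega), not_le.2 (show jj₂ - 1 < N ψ by omega)]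
          rw [← h1, ← h2, ht]
        subst hi
        have hj : jj₁ = jj₂ := by omega
        subst hj; exact ⟨rfl, rfl⟩
      · -- tile / clause : sizes differ
        exfalso
        subst hi₂
        have : i₁ * N ψ + (jj₁ - 1) < V ψ * N ψ := by
          calc i₁ * N ψ + (jj₁ - 1) < i₁ * N ψ + N ψ := by omega
            _ = (i₁ + 1) * N ψ := by ring
            _ ≤ V ψ * N ψ := Nat.mul_le_mul_right _ hi₁
        rcases hcl₂ _ _ _ _ hb₂' with rfl | ⟨rfl, -⟩
        · rw [if_pos hf₁, if_neg (by omega), if_pos rfl] at hg; omega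
        · rw [if_pos hf₁, if_neg (by omega), if_neg (by omega)] at hg; omega

/-- The tile coordinates are listed once. [folklore] -/
theorem nodup_tcoords : (tcoords ψ).Nodup := by
  unfold tcoords
  refine List.nodup_cons.2 ⟨fun h => ?_, ?_⟩
  · simp only [List.mem_flatMap, List.mem_range, List.mem_map, Prod.mk.injEq] at h
    obtain ⟨_, _, _, _, _, h⟩ := h; omega
  · rw [List.nodup_flatMap]
    constructor
    · intro i _
      exact (List.nodup_range.map_on fun a _ b _ h => by simpa using h)
    · refine List.nodup_range.pairwise_of_forall_ne fun i _ i' _ hne => ?_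
      simp only [Function.onFun, List.disjoint_left, List.mem_map, List.mem_range]
      rintro _ ⟨j, _, rfl⟩ ⟨j', _, h⟩
      simp only [Prod.mk.injEq] at h; omega

/-- The objects are listed once. [folklore] -/
theorem nodup_objs : (objs ψ).Nodup := by
  unfold objs
  rw [List.nodup_flatMap]
  constructor
  · intro t _
    exact (nodup_bundle _).map_on fun a _ b _ h => by simpa using h
  · refine (nodup_tcoords).pairwise_of_forall_ne fun t _ t' _ hne => ?_
    simp only [Function.onFun, List.disjoint_left, List.mem_map]
    rintro _ ⟨κ, _, rfl⟩ ⟨κ', _, h⟩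
    simp only [Prod.mk.injEq] at h
    exact hne (Prod.ext h.2.1.symm h.2.2.symm)

/-- **The own vertex names are pairwise distinct.** [folklore] -/
theorem nodup_verts (hw : WidthOK ψ) : (drawing ψ).verts.Nodup := by
  show ((objs ψ).flatMap (overts ψ)).Nodup
  rw [List.nodup_flatMap]
  constructor
  · intro o ho
    unfold overts Kind.ownKeys
    rw [List.map_map]
    refine (nodup_verts_keys o.1 |> fun h => ?_)
    have hv : o.1.verts.Nodup := h.of_map _
    exact hv.map_on fun a ha b hb hab => by
      have := (oname_inj hw ho ho ha hb hab).2
      -- keys are distinct, so equal keys mean equal entries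
      exact (List.inj_on_of_nodup_map h) ha hb this
  · refine (nodup_objs).pairwise_of_forall_ne fun o₁ h₁ o₂ h₂ hne => ?_
    simp only [Function.onFun, List.disjoint_left, overts, Kind.ownKeys, List.map_map, List.mem_map, Function.comp]
    rintro _ ⟨a₁, ha₁, rfl⟩ ⟨a₂, ha₂, h⟩
    exact hne (oname_inj hw h₁ h₂ ha₁ ha₂ h.symm).1

/-- The keys of `vposList` are the listed vertices. [folklore] -/
theorem map_fst_vposList : (vposList ψ).map Prod.fst = (drawing ψ).verts := by
  show _ = (objs ψ).flatMap (overts ψ)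
  unfold vposList overts Kind.ownKeys
  rw [List.map_flatMap]
  congr 1
  funext o
  simp [List.map_map, Function.comp]

/-- **The position of an own vertex.** [folklore] -/
theorem gpos_own (hw : WidthOK ψ) {o : Obj} (ho : o ∈ objs ψ) {a : Ref × GridPoint} (ha : a ∈ o.1.verts) :
    gpos ψ (oname ψ o a.1) = shiftPt (oanchor ψ o) a.2 :=
  gpos_eq ψ (by rw [map_fst_vposList]; exact nodup_verts hw) ho ha

/-! ### Absolute references -/

/-- **The absolute datum of a reference seen from tile `(i, jj)`**: the referenced tile and the
vertex datum. [folklore] -/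
def absRef (i jj : ℕ) : Ref → (ℤ × ℤ) × (ℕ × ℕ ⊕ ℕ × ℕ)
  | .cell di dj c l => (((i : ℤ) + di, (jj : ℤ) + dj), .inl (c, l))
  | .gad di dj f idx => (((i : ℤ) + di, (jj : ℤ) + dj), .inr (f, idx))

/-- The name of a reference depends only on its absolute datum. [folklore] -/
theorem gname_eq_of_absRef_eq {i jj i' jj' : ℕ} {r r' : Ref} (h : absRef i jj r = absRef i' jj' r') :
    gname ψ i jj r = gname ψ i' jj' r' := by
  cases r <;> cases r' <;> simp only [absRef, Prod.mk.injEq, Sum.inl.injEq, Sum.inr.injEq, reduceCtorEq, and_false] at h <;>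
    simp only [gname]
  · obtain ⟨⟨h1, h2⟩, h3, h4⟩ := h; rw [h1, h2, h3, h4]
  · obtain ⟨⟨h1, h2⟩, h3, h4⟩ := h; rw [h1, h2, h3, h4]

/-- Re-anchoring preserves the absolute datum. [folklore] -/
theorem absRef_reRef {i jj i' jj' : ℕ} (r : Ref) :
    absRef i jj (Kind.reRef ((i' : ℤ) - i, (jj' : ℤ) - jj) r) = absRef i' jj' r := by
  cases r <;> simp only [absRef, Kind.reRef, Prod.mk.injEq] <;> exact ⟨⟨by omega, by omega⟩, trivial⟩

/-- The absolute datum is injective on the references seen from one tile. [folklore] -/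
theorem absRef_injective (i jj : ℕ) : Function.Injective (absRef i jj) := by
  intro r r' h
  cases r <;> cases r' <;> simp only [absRef, Prod.mk.injEq, Sum.inl.injEq, Sum.inr.injEq, reduceCtorEq, and_false] at h
  · obtain ⟨⟨h1, h2⟩, h3, h4⟩ := h; congr <;> omega
  · obtain ⟨⟨h1, h2⟩, h3, h4⟩ := h; congr <;> omega

/-- The name of a re-anchored reference. [folklore] -/
theorem oname_reRef (o₁ o₂ : Obj) (r : Ref) :
    oname ψ o₁ (Kind.reRef ((o₂.2.1 : ℤ) - o₁.2.1, (o₂.2.2 : ℤ) - o₁.2.2) r) = oname ψ o₂ r :=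
  gname_eq_of_absRef_eq (absRef_reRef r)

/-! ### Foreign references of actual objects resolve -/

/-- Anchors differ by the translation of the tile offset. [folklore] -/
theorem anchor_eq_shift {i jj i' jj' : ℕ} (hi : i ≤ V ψ) (hi' : i' ≤ V ψ) :
    anchor ψ i jj = shiftPt (Kind.shiftOf ((i : ℤ) - i', (jj : ℤ) - jj')) (anchor ψ i' jj') := by
  simp only [anchor, Kind.shiftOf, shiftPt, Prod.mk.injEq]
  push_cast
  constructor
  · ring
  · rw [Nat.cast_sub hi, Nat.cast_sub hi']; ring

/-- Translations compose additively. [folklore] -/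
theorem shiftPt_add (u v p : GridPoint) : shiftPt u (shiftPt v p) = shiftPt (shiftPt u v) p := by
  simp only [shiftPt, Prod.mk.injEq]; omega

/-- The target tile of a foreign reference of an actual object exists, at an axis offset.
[folklore] -/
theorem phantom_target (hw : WidthOK ψ) (hN : 0 < N ψ) {o : Obj} (ho : o ∈ objs ψ) {q : Ref × GridPoint}
    (hq : q ∈ o.1.phantoms) :
    ∃ i' jj' : ℕ, (i', jj') ∈ tcoords ψ ∧ ((i' : ℤ), (jj' : ℤ)) = ((o.2.1 : ℤ) + q.1.offset.1, (o.2.2 : ℤ) + q.1.offset.2) ∧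
      ((o.2.1 : ℤ) - i', (o.2.2 : ℤ) - jj') ∈ axisOffsets := by
  obtain ⟨κ, i, jj⟩ := o
  obtain ⟨ht, hb⟩ := (mem_objs_iff ψ).1 ho
  simp only at ht hb ⊢
  obtain ⟨hoff, -⟩ := offOK_of_mem hb hq
  have htc := (mem_tcoords_iff ψ (t := (i, jj))).1 ht
  simp only [Prod.mk.injEq] at htc
  rcases tile_classes ht with ⟨rfl, rfl, hb'⟩ | ⟨hi, hj, hj', hb'⟩ | ⟨hi, hj, hj', hV, hb'⟩ <;> rw [hb'] at hoff <;>
    simp only [BSpec.offOK, BSpec.east, Bool.or_eq_true, Bool.and_eq_true, decide_eq_true_eq, Bool.false_eq_true,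
      and_false, or_false, and_true] at hoff
  · -- doubler: offsets (0,0) and (0,1)
    rcases hoff with h | h <;> rw [h]
    · exact ⟨0, 0, ht, by simp, by decide⟩
    · exact ⟨0, 1, (mem_tcoords_iff ψ).2 (Or.inr ⟨by simp, le_rfl, hN⟩), by simp, by decide⟩
  · -- tile row
    rcases hoff with ((h | ⟨h, hw'⟩) | ⟨h, hc⟩) | ⟨h, he⟩ <;> rw [h]
    · exact ⟨i, jj, ht, by simp, by simp [axisOffsets]⟩
    · refine ⟨i, jj - 1, (mem_tcoords_iff ψ).2 (Or.inr ⟨by simp; omega, by simp; omega, by simp; omega⟩), ?_, ?_⟩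
      · simp only [Prod.mk.injEq]; omega
      · have : (jj : ℤ) - ((jj - 1 : ℕ) : ℤ) = 1 := by omega
        rw [sub_self, this]; decide
    · have hi0 : i ≠ 0 := by rintro rfl; exact tk3_zero_ne_c _ hc
      refine ⟨i - 1, jj, (mem_tcoords_iff ψ).2 (Or.inr ⟨by simp; omega, by simpa using hj, by simpa using hj'⟩), ?_, ?_⟩
      · simp only [Prod.mk.injEq]; omega
      · have : (i : ℤ) - ((i - 1 : ℕ) : ℤ) = 1 := by omega
        rw [sub_self, this]; decide
    · refine ⟨i, jj + 1, (mem_tcoords_iff ψ).2 (Or.inr ⟨by simp; omega, by simp, by simp; omega⟩), ?_, ?_⟩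
      · simp only [Prod.mk.injEq]; push_cast; omega
      · have : (jj : ℤ) - ((jj + 1 : ℕ) : ℤ) = -1 := by push_cast; omega
        rw [sub_self, this]; decide
  · -- clause row
    subst hi
    rcases hoff with ((h | h) | ⟨h, he⟩) | ⟨h, hr⟩ <;> rw [h]
    · exact ⟨V ψ, jj, ht, by simp, by simp [axisOffsets]⟩
    · refine ⟨V ψ - 1, jj, (mem_tcoords_iff ψ).2 (Or.inr ⟨by simp, by simpa using hj, by simpa using hj'⟩), ?_, ?_⟩
      · simp only [Prod.mk.injEq]; omega
      · have : ((V ψ : ℕ) : ℤ) - ((V ψ - 1 : ℕ) : ℤ) = 1 := by omega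
        rw [sub_self, this]; decide
    · refine ⟨V ψ, jj + 1, (mem_tcoords_iff ψ).2 (Or.inr ⟨by simp, by simp, by simp; omega⟩), ?_, ?_⟩
      · simp only [Prod.mk.injEq]; push_cast; omega
      · have : (jj : ℤ) - ((jj + 1 : ℕ) : ℤ) = -1 := by push_cast; omega
        rw [sub_self, this]; decide
    · have := lt_N_of_roleOf_or3a hw (show jj - 1 < N ψ by omega) hr
      refine ⟨V ψ, jj + 2, (mem_tcoords_iff ψ).2 (Or.inr ⟨by simp, by simp, by simp; omega⟩), ?_, ?_⟩
      · simp only [Prod.mk.injEq]; push_cast; omega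
      · have : (jj : ℤ) - ((jj + 2 : ℕ) : ℤ) = -2 := by push_cast; omega
        rw [sub_self, this]; decide

/-- **A foreign reference of an actual object names an own vertex of an actual object at the
referenced tile, drawn at the foreign position.** [folklore] -/
theorem phantom_resolve (hw : WidthOK ψ) (hN : 0 < N ψ) {o : Obj} (ho : o ∈ objs ψ) {q : Ref × GridPoint}
    (hq : q ∈ o.1.phantoms) :
    ∃ o' ∈ objs ψ, ∃ a ∈ o'.1.verts, oname ψ o q.1 = oname ψ o' a.1 ∧
      absRef o.2.1 o.2.2 q.1 = absRef o'.2.1 o'.2.2 a.1 ∧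
      gpos ψ (oname ψ o q.1) = shiftPt (oanchor ψ o) q.2 := by
  obtain ⟨i', jj', ht', hco, hΔ⟩ := phantom_target hw hN ho hq
  obtain ⟨κ, i, jj⟩ := o
  obtain ⟨ht, hb⟩ := (mem_objs_iff ψ).1 ho
  simp only at ht hb hco hΔ ⊢
  simp only [Prod.mk.injEq] at hco
  obtain ⟨hci, hcj⟩ := hco
  have hbounds : ((i : ℤ) - i' ≤ 1 ∧ -1 ≤ (i : ℤ) - i') ∧ ((jj : ℤ) - jj' ≤ 2 ∧ -2 ≤ (jj : ℤ) - jj') := by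
    have := hΔ; simp only [axisOffsets, List.mem_cons, List.not_mem_nil, or_false, Prod.mk.injEq] at this
    omega
  have hreal := realizable_bspecAt hw ht' ht (a := (i : ℤ) - i') (b := (jj : ℤ) - jj') rfl rfl hbounds.1 hbounds.2
  have hoffq : q.1.offset = (-((i : ℤ) - i'), -((jj : ℤ) - jj')) := by
    obtain ⟨r, p⟩ := q
    cases r <;> simp only [Ref.offset, Prod.mk.injEq] at hci hcj ⊢ <;> constructor <;> omega
  obtain ⟨κ₁, hκ₁, a, ha, hak⟩ := resolve_of_realizable hreal hΔ hb hq hoffq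
  have ho' : ((κ₁, i', jj') : Obj) ∈ objs ψ := (mem_objs_iff ψ).2 ⟨ht', hκ₁⟩
  -- the referenced vertex is a cell vertex
  obtain ⟨-, hcell⟩ := offOK_of_mem hb hq
  obtain ⟨r, p⟩ := q
  cases r with
  | gad => simp [Ref.isCell] at hcell
  | cell di dj c l =>
  simp only [Ref.offset] at hci hcj
  have hname : oname ψ (κ, i, jj) (.cell di dj c l) = oname ψ (κ₁, i', jj') a.1 := by
    rw [hak]
    simp only [oname, gname, Kind.reRef]
    congr 2
    all_goals (congr 1 <;> omega)
  refine ⟨(κ₁, i', jj'), ho', a, ha, hname, ?_, ?_⟩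
  · rw [hak]; exact (absRef_reRef (i := i') (jj := jj') (i' := i) (jj' := jj) _).symm
  -- positions: the filter gives agreement of the foreign point with the own vertex
  have hne : κ₁ ≠ κ ∨ ((i : ℤ) - i', (jj : ℤ) - jj') ≠ (0, 0) := by
    by_cases hΔ0 : ((i : ℤ) - i', (jj : ℤ) - jj') = (0, 0)
    · left
      rintro rfl
      -- a reference cannot be both own and foreign in one kind
      have hkeys := nodup_posTable_keys κ₁
      rw [Kind.posTable, List.map_append, List.nodup_append] at hkeys
      refine hkeys.2.2 _ (List.mem_map.2 ⟨a, ha, rfl⟩) _ (List.mem_map.2 ⟨_, hq, rfl⟩) ?_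
      simp only [Prod.mk.injEq] at hΔ0
      rw [hak]; simp only [Kind.reRef, hΔ0.1, hΔ0.2, add_zero]
    · exact Or.inr hΔ0
  have hnear : ((i : ℤ) - i', (jj : ℤ) - jj') ∈ nearOffsets :=
    mem_nearOffsets_of hbounds.1.2 hbounds.1.1 hbounds.2.2 hbounds.2.1
  have hm := mayCooccur_of_realizable_axis hreal hΔ hκ₁ hb hne
  have hph := phantomOKB_of_mayCooccur hm hnear
  simp only [Kind.phantomOKB, Bool.and_eq_true, List.all_eq_true] at hph
  have h1 := hph.1 _ hq
  rw [← hak, lookup_eq_of_nodup_keys (nodup_verts_keys κ₁) (show (a.1, a.2) ∈ κ₁.verts from ha)] at h1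
  simp only [decide_eq_true_eq] at h1
  -- assemble
  rw [hname, gpos_own hw ho' ha, ← h1, oanchor, oanchor, shiftPt_add]
  simp only
  congr 1
  have hti := ((mem_tcoords_iff ψ (t := (i, jj))).1 ht)
  have hti' := ((mem_tcoords_iff ψ (t := (i', jj'))).1 ht')
  simp only [Prod.mk.injEq] at hti hti'
  rw [anchor_eq_shift (i := i) (jj := jj) (i' := i') (jj' := jj') (by omega) (by omega)]
  simp only [shiftPt, Kind.shiftOf, Prod.mk.injEq]
  constructor <;> ring

/-! ### Reading the single-edge and local checks -/

/-- The well-formedness facts of one edge of a kind. [folklore] -/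
theorem edgeWF_of_mem {κ : Kind} {e : Ref × Ref × List GridPoint} (he : e ∈ κ.wedges) :
    e.1 ∈ (κ.posTable).map Prod.fst ∧ e.2.1 ∈ (κ.posTable).map Prod.fst ∧ e.1 ≠ e.2.1 ∧
    (poly e.2.2).head? = some (κ.lpos e.1) ∧ (poly e.2.2).getLast? = some (κ.lpos e.2.1) ∧
    e.2.2.head? = some (κ.lpos e.1) ∧ e.2.2.getLast? = some (κ.lpos e.2.1) ∧
    (poly e.2.2).Nodup ∧ List.IsChain IsGridEdge (poly e.2.2) ∧ 2 ≤ e.2.2.length := by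
  have := edgesWF_all κ
  unfold Kind.edgesWF at this
  simp only [List.all_eq_true, Bool.and_eq_true, decide_eq_true_eq, List.contains_iff_mem] at this
  obtain ⟨⟨⟨⟨⟨⟨⟨⟨⟨h1, h2⟩, h3⟩, h4⟩, h5⟩, h6⟩, h7⟩, h8⟩, h9⟩, h10⟩ := this e he
  exact ⟨h1, h2, h3, h4, h5, h6, h7, h8, h9, h10⟩

/-- The three parts of the local congestion check of a kind. [folklore] -/
theorem localOK_parts (κ : Kind) :
    (∀ a ∈ κ.posTable, ∀ b ∈ κ.posTable, a.2 = b.2 → a.1 = b.1) ∧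
    (∀ a ∈ κ.posTable, ∀ e ∈ κ.wedges, ptEdgeB a.2 e.2.2 (0, 0) = true) ∧
    (∀ e ∈ κ.wedges, ∀ e' ∈ κ.wedges, e ≠ e' → edgeEdgeB e.2.2 e'.2.2 (0, 0) = true ∧
      ¬ (e.1 = e'.1 ∧ e.2.1 = e'.2.1) ∧ ¬ (e.1 = e'.2.1 ∧ e.2.1 = e'.1)) := by
  have := localOK_all κ
  unfold Kind.localOK at this
  simp only [List.all_eq_true, Bool.and_eq_true, decide_eq_true_eq, Bool.or_eq_true, Bool.not_eq_true',
    Bool.and_eq_false_imp, decide_eq_false_iff_not] at this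
  obtain ⟨⟨h1, h2⟩, h3⟩ := this
  refine ⟨h1, h2, fun e he e' he' hne => ?_⟩
  rcases h3 e he e' he' with h | ⟨⟨h4, h5⟩, h6⟩
  · exact absurd h hne
  · exact ⟨h4, fun h => h5 h.1 h.2, fun h => h6 h.1 h.2⟩

/-- The parts of the compatibility check of two kinds at an offset. [folklore] -/
theorem compatB_parts {κ₁ κ₂ : Kind} {Δ : ℤ × ℤ} (h : Kind.compatB κ₁ κ₂ Δ = true) :
    boxApartB κ₁.bbox κ₂.bbox (Kind.shiftOf Δ) = true ∨
    ((∀ a ∈ κ₁.verts, ∀ b ∈ κ₂.verts, a.2 ≠ shiftPt (Kind.shiftOf Δ) b.2) ∧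
     (∀ a ∈ κ₁.posTable, ∀ e ∈ κ₂.wedges, ptEdgeB a.2 e.2.2 (Kind.shiftOf Δ) = true) ∧
     (∀ b ∈ κ₂.posTable, ∀ e ∈ κ₁.wedges, ptEdgeB (shiftPt (Kind.shiftOf Δ) b.2) e.2.2 (0, 0) = true) ∧
     (∀ e ∈ κ₁.wedges, ∀ e' ∈ κ₂.wedges, edgeEdgeB e.2.2 e'.2.2 (Kind.shiftOf Δ) = true ∧
       ¬ (e.1 = Kind.reRef Δ e'.1 ∧ e.2.1 = Kind.reRef Δ e'.2.1) ∧ ¬ (e.1 = Kind.reRef Δ e'.2.1 ∧ e.2.1 = Kind.reRef Δ e'.1))) := by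
  unfold Kind.compatB at h
  simp only [Bool.or_eq_true, Bool.and_eq_true, List.all_eq_true, decide_eq_true_eq, Bool.not_eq_true',
    Bool.and_eq_false_imp, decide_eq_false_iff_not] at h
  rcases h with h | ⟨⟨⟨h1, h2⟩, h3⟩, h4⟩
  · exact Or.inl h
  · refine Or.inr ⟨h1, h2, h3, fun e he e' he' => ?_⟩
    obtain ⟨⟨h5, h6⟩, h7⟩ := h4 e he e' he'
    exact ⟨h5, fun hh => h6 hh.1 hh.2, fun hh => h7 hh.1 hh.2⟩

/-! ### Listed references of actual objects -/

/-- **A listed reference of an actual object** names an own vertex of an actual object with the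
same absolute datum, drawn at the translated local position. [folklore] -/
theorem end_resolve (hw : WidthOK ψ) (hN : 0 < N ψ) {o : Obj} (ho : o ∈ objs ψ) {r : Ref}
    (hr : r ∈ (o.1.posTable).map Prod.fst) :
    (∃ o' ∈ objs ψ, ∃ a ∈ o'.1.verts, oname ψ o r = oname ψ o' a.1 ∧ absRef o.2.1 o.2.2 r = absRef o'.2.1 o'.2.2 a.1) ∧
    gpos ψ (oname ψ o r) = shiftPt (oanchor ψ o) (o.1.lpos r) := by
  rw [Kind.posTable, List.map_append, List.mem_append] at hr
  rcases hr with hr | hr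
  · obtain ⟨a, ha, rfl⟩ := List.mem_map.1 hr
    exact ⟨⟨o, ho, a, ha, rfl, rfl⟩, by rw [lpos_of_mem_verts ha]; exact gpos_own hw ho ha⟩
  · obtain ⟨q, hq, rfl⟩ := List.mem_map.1 hr
    obtain ⟨o', ho', a, ha, hname, habs, hpos⟩ := phantom_resolve hw hN ho hq
    exact ⟨⟨o', ho', a, ha, hname, habs⟩, by rw [lpos_of_mem_phantoms hq]; exact hpos⟩

/-- A listed reference of an actual object names a drawn vertex. [folklore] -/
theorem oname_mem_verts (hw : WidthOK ψ) (hN : 0 < N ψ) {o : Obj} (ho : o ∈ objs ψ) {r : Ref}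
    (hr : r ∈ (o.1.posTable).map Prod.fst) : oname ψ o r ∈ (drawing ψ).verts := by
  obtain ⟨⟨o', ho', a, ha, hname, -⟩, -⟩ := end_resolve hw hN ho hr
  rw [hname]
  show oname ψ o' a.1 ∈ (objs ψ).flatMap (overts ψ)
  exact List.mem_flatMap.2 ⟨o', ho', List.mem_map.2 ⟨a.1, List.mem_map.2 ⟨a, ha, rfl⟩, rfl⟩⟩

/-- **Equal names of listed references of actual objects have equal absolute data.** [folklore] -/
theorem absRef_eq_of_oname_eq (hw : WidthOK ψ) (hN : 0 < N ψ) {o₁ o₂ : Obj} (h₁ : o₁ ∈ objs ψ) (h₂ : o₂ ∈ objs ψ)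
    {r₁ r₂ : Ref} (hr₁ : r₁ ∈ (o₁.1.posTable).map Prod.fst) (hr₂ : r₂ ∈ (o₂.1.posTable).map Prod.fst)
    (h : oname ψ o₁ r₁ = oname ψ o₂ r₂) : absRef o₁.2.1 o₁.2.2 r₁ = absRef o₂.2.1 o₂.2.2 r₂ := by
  obtain ⟨⟨p₁, hp₁, a₁, ha₁, hn₁, habs₁⟩, -⟩ := end_resolve hw hN h₁ hr₁
  obtain ⟨⟨p₂, hp₂, a₂, ha₂, hn₂, habs₂⟩, -⟩ := end_resolve hw hN h₂ hr₂
  rw [hn₁, hn₂] at h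
  obtain ⟨rfl, ha⟩ := oname_inj hw hp₁ hp₂ ha₁ ha₂ h
  rw [habs₁, habs₂, ha]

/-- Names are injective on the listed references of one actual object. [folklore] -/
theorem oname_inj_posTable (hw : WidthOK ψ) (hN : 0 < N ψ) {o : Obj} (ho : o ∈ objs ψ) {r₁ r₂ : Ref}
    (hr₁ : r₁ ∈ (o.1.posTable).map Prod.fst) (hr₂ : r₂ ∈ (o.1.posTable).map Prod.fst)
    (h : oname ψ o r₁ = oname ψ o r₂) : r₁ = r₂ :=
  absRef_injective _ _ (absRef_eq_of_oname_eq hw hN ho ho hr₁ hr₂ h)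

/-- Names of listed references of two actual objects agree only along re-anchoring. [folklore] -/
theorem eq_reRef_of_oname_eq (hw : WidthOK ψ) (hN : 0 < N ψ) {o₁ o₂ : Obj} (h₁ : o₁ ∈ objs ψ) (h₂ : o₂ ∈ objs ψ)
    {r₁ r₂ : Ref} (hr₁ : r₁ ∈ (o₁.1.posTable).map Prod.fst) (hr₂ : r₂ ∈ (o₂.1.posTable).map Prod.fst)
    (h : oname ψ o₁ r₁ = oname ψ o₂ r₂) :
    r₁ = Kind.reRef ((o₂.2.1 : ℤ) - o₁.2.1, (o₂.2.2 : ℤ) - o₁.2.2) r₂ := by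
  apply absRef_injective o₁.2.1 o₁.2.2
  rw [absRef_eq_of_oname_eq hw hN h₁ h₂ hr₁ hr₂ h, absRef_reRef]

/-! ### Near and far pairs of objects -/

/-- Two tiles are NEAR: at most one row and two columns apart. [folklore] -/
def Near (o₁ o₂ : Obj) : Prop :=
  (o₂.2.1 : ℤ) - o₁.2.1 ≤ 1 ∧ -1 ≤ (o₂.2.1 : ℤ) - o₁.2.1 ∧ (o₂.2.2 : ℤ) - o₁.2.2 ≤ 2 ∧ -2 ≤ (o₂.2.2 : ℤ) - o₁.2.2

/-- The tile offset from the first object to the second. [folklore] -/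
def offs (o₁ o₂ : Obj) : ℤ × ℤ := ((o₂.2.1 : ℤ) - o₁.2.1, (o₂.2.2 : ℤ) - o₁.2.2)

/-- **Near actual objects pass the filter.** [folklore] -/
theorem mayCooccur_of_near (hw : WidthOK ψ) {o₁ o₂ : Obj} (h₁ : o₁ ∈ objs ψ) (h₂ : o₂ ∈ objs ψ) (hne : o₁ ≠ o₂)
    (hnear : Near o₁ o₂) : mayCooccur o₁.1 o₂.1 (offs o₁ o₂) = true := by
  obtain ⟨κ₁, i₁, jj₁⟩ := o₁
  obtain ⟨κ₂, i₂, jj₂⟩ := o₂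
  obtain ⟨ht₁, hb₁⟩ := (mem_objs_iff ψ).1 h₁
  obtain ⟨ht₂, hb₂⟩ := (mem_objs_iff ψ).1 h₂
  simp only [Near, offs] at hnear ht₁ ht₂ hb₁ hb₂ ⊢
  obtain ⟨hd1, hd2, hd3, hd4⟩ := hnear
  rcases mem_axis_or_offAxis hd2 hd1 hd4 hd3 with hax | hoff
  · refine mayCooccur_of_realizable_axis (realizable_bspecAt hw ht₁ ht₂ rfl rfl ⟨hd1, hd2⟩ ⟨hd3, hd4⟩) hax hb₁ hb₂ ?_
    by_contra hc
    simp only [not_or, not_not, Prod.mk.injEq] at hc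
    obtain ⟨rfl, h1, h2⟩ := hc
    exact hne (by congr 1; exact Prod.ext (by simp only; omega) (by simp only; omega))
  · refine mayCooccur_of_offAxis hoff (fun h1 => ?_) (fun h1 => ?_)
    · -- the first object is above: a tile-row object (or the doubler's)
      have hti := (mem_tcoords_iff ψ (t := (i₂, jj₂))).1 ht₂
      simp only [Prod.mk.injEq] at hti h1
      rcases tile_classes ht₁ with ⟨-, -, hb⟩ | ⟨-, -, -, hb⟩ | ⟨hi, -, -, -, -⟩
      · rw [hb] at hb₁; exact rowClass_of_mem_bundle hb₁
      · rw [hb] at hb₁; exact rowClass_of_mem_bundle hb₁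
      · exfalso; omega
    · have hti := (mem_tcoords_iff ψ (t := (i₁, jj₁))).1 ht₁
      simp only [Prod.mk.injEq] at hti h1
      rcases tile_classes ht₂ with ⟨-, -, hb⟩ | ⟨-, -, -, hb⟩ | ⟨hi, -, -, -, -⟩
      · rw [hb] at hb₂; exact rowClass_of_mem_bundle hb₂
      · rw [hb] at hb₂; exact rowClass_of_mem_bundle hb₂
      · exfalso; omega

/-- The near offset is a listed near offset. [folklore] -/
theorem offs_mem_nearOffsets {o₁ o₂ : Obj} (h : Near o₁ o₂) : offs o₁ o₂ ∈ nearOffsets :=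
  mem_nearOffsets_of h.2.1 h.1 h.2.2.2 h.2.2.1

/-- **Near distinct actual objects are compatible.** [folklore] -/
theorem compatB_of_near (hw : WidthOK ψ) {o₁ o₂ : Obj} (h₁ : o₁ ∈ objs ψ) (h₂ : o₂ ∈ objs ψ) (hne : o₁ ≠ o₂)
    (hnear : Near o₁ o₂) : Kind.compatB o₁.1 o₂.1 (offs o₁ o₂) = true := by
  refine compatB_of_mayCooccur (mayCooccur_of_near hw h₁ h₂ hne hnear) (offs_mem_nearOffsets hnear) ?_
  by_contra hc
  simp only [not_or, not_not, offs, Prod.mk.injEq] at hc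
  obtain ⟨hk, h1, h2⟩ := hc
  exact hne (Prod.ext hk (Prod.ext (by omega) (by omega)))

/-- The anchors of two objects differ by the translation of their offset. [folklore] -/
theorem oanchor_eq_shift {o₁ o₂ : Obj} (h₁ : o₁ ∈ objs ψ) (h₂ : o₂ ∈ objs ψ) :
    oanchor ψ o₂ = shiftPt (Kind.shiftOf (offs o₁ o₂)) (oanchor ψ o₁) := by
  have ht₁ := (mem_tcoords_iff ψ).1 ((mem_objs_iff ψ).1 h₁).1
  have ht₂ := (mem_tcoords_iff ψ).1 ((mem_objs_iff ψ).1 h₂).1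
  simp only [Prod.mk.injEq] at ht₁ ht₂
  exact anchor_eq_shift (by omega) (by omega)

/-- Translation by the anchor is injective. [folklore] -/
theorem shiftPt_oanchor_inj {o : Obj} {p q : GridPoint} (h : shiftPt (oanchor ψ o) p = shiftPt (oanchor ψ o) q) : p = q :=
  shiftPt_injective _ h

/-- Relative coordinates of a common global point of two objects. [folklore] -/
theorem local_eq_shift_of_global_eq {o₁ o₂ : Obj} (h₁ : o₁ ∈ objs ψ) (h₂ : o₂ ∈ objs ψ) {p q : GridPoint}
    (h : shiftPt (oanchor ψ o₁) p = shiftPt (oanchor ψ o₂) q) : p = shiftPt (Kind.shiftOf (offs o₁ o₂)) q := by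
  rw [oanchor_eq_shift h₁ h₂] at h
  obtain ⟨p₁, p₂⟩ := p
  obtain ⟨q₁, q₂⟩ := q
  simp only [shiftPt, Kind.shiftOf, Prod.mk.injEq] at h ⊢
  omega

/-- **Points of far objects differ**: local coordinates in the box `[-10, 257] × [-27, 160]`,
anchors at least `3 · 117` apart horizontally or `2 · 160` vertically. [folklore] -/
theorem ne_of_far {o₁ o₂ : Obj} (h₁ : o₁ ∈ objs ψ) (h₂ : o₂ ∈ objs ψ) (hfar : ¬ Near o₁ o₂) {p q : GridPoint}
    (hp : inBoxB (-10) 257 (-27) 160 p = true) (hq : inBoxB (-10) 257 (-27) 160 q = true) :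
    shiftPt (oanchor ψ o₁) p ≠ shiftPt (oanchor ψ o₂) q := by
  intro h
  have := local_eq_shift_of_global_eq h₁ h₂ h
  rw [inBoxB_iff] at hp hq
  simp only [Near, not_and_or, not_le] at hfar
  simp only [this, shiftPt, Kind.shiftOf, offs] at hp
  omega

/-- Listed local positions lie in the box. [folklore] -/
theorem inBox_of_mem_posTable {κ : Kind} {a : Ref × GridPoint} (ha : a ∈ κ.posTable) : inBoxB (-10) 257 (-27) 160 a.2 = true :=
  inBox_local (List.mem_append_left _ (List.mem_map.2 ⟨a, ha, rfl⟩))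

/-- Own local positions lie in the box. [folklore] -/
theorem inBox_of_mem_verts {κ : Kind} {a : Ref × GridPoint} (ha : a ∈ κ.verts) : inBoxB (-10) 257 (-27) 160 a.2 = true :=
  inBox_of_mem_posTable (by rw [Kind.posTable]; exact List.mem_append_left _ ha)

/-- Points of the drawn paths lie in the box. [folklore] -/
theorem inBox_of_mem_poly {κ : Kind} {e : Ref × Ref × List GridPoint} (he : e ∈ κ.wedges) {p : GridPoint}
    (hp : p ∈ poly e.2.2) : inBoxB (-10) 257 (-27) 160 p = true := by
  have hc : ∀ c ∈ e.2.2, inBoxB (-10) 257 (-27) 160 c = true := fun c hc =>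
    inBox_local (List.mem_append_right _ (List.mem_flatMap.2 ⟨e, he, hc⟩))
  rcases mem_poly_exists hp with ⟨a, b, hab, hin⟩ | h
  · have ha := hc a (hab.subset (by simp))
    have hb := hc b (hab.subset (by simp))
    rw [inBoxB_iff] at ha hb ⊢
    exact within_of_inCseg (b := ((-10 : ℤ), (257 : ℤ), (-27 : ℤ), (160 : ℤ))) ha hb hin
  · exact hc p (by rw [h]; simp)

/-- The local position of a listed reference lies in the box. [folklore] -/
theorem inBox_lpos {κ : Kind} {r : Ref} (hr : r ∈ (κ.posTable).map Prod.fst) : inBoxB (-10) 257 (-27) 160 (κ.lpos r) = true := by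
  obtain ⟨a, ha, rfl⟩ := List.mem_map.1 hr
  rw [Kind.posTable, List.mem_append] at ha
  rcases ha with ha | ha
  · rw [lpos_of_mem_verts ha]; exact inBox_of_mem_verts ha
  · rw [lpos_of_mem_phantoms ha]; exact inBox_of_mem_posTable (by rw [Kind.posTable]; exact List.mem_append_right _ ha)

/-! ### Injectivity of positions -/

/-- **Distinct drawn vertices sit at distinct points.** [folklore] -/
theorem pos_inj (hw : WidthOK ψ) {o₁ o₂ : Obj} (h₁ : o₁ ∈ objs ψ) (h₂ : o₂ ∈ objs ψ) {a₁ a₂ : Ref × GridPoint}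
    (ha₁ : a₁ ∈ o₁.1.verts) (ha₂ : a₂ ∈ o₂.1.verts)
    (h : shiftPt (oanchor ψ o₁) a₁.2 = shiftPt (oanchor ψ o₂) a₂.2) : o₁ = o₂ ∧ a₁.1 = a₂.1 := by
  by_cases hne : o₁ = o₂
  · subst hne
    refine ⟨rfl, (localOK_parts o₁.1).1 a₁ ?_ a₂ ?_ (shiftPt_oanchor_inj h)⟩ <;>
      rw [Kind.posTable] <;> exact List.mem_append_left _ ‹_›
  · exfalso
    by_cases hnear : Near o₁ o₂
    · rcases compatB_parts (compatB_of_near hw h₁ h₂ hne hnear) with hbox | ⟨hvv, -⟩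
      · refine ne_of_boxApartB hbox ?_ ?_ (local_eq_shift_of_global_eq h₁ h₂ h)
        · exact within_bboxOf_of_mem (List.mem_append_left _ (List.mem_map.2 ⟨a₁, by
            rw [Kind.posTable]; exact List.mem_append_left _ ha₁, rfl⟩))
        · exact within_bboxOf_of_mem (List.mem_append_left _ (List.mem_map.2 ⟨a₂, by
            rw [Kind.posTable]; exact List.mem_append_left _ ha₂, rfl⟩))
      · exact hvv a₁ ha₁ a₂ ha₂ (local_eq_shift_of_global_eq h₁ h₂ h)
    · exact ne_of_far h₁ h₂ hnear (inBox_of_mem_verts ha₁) (inBox_of_mem_verts ha₂) h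

/-- **Drawn vertices: a name and its position determine each other.** [folklore] -/
theorem name_eq_of_pos_eq (hw : WidthOK ψ) {o₁ o₂ : Obj} (h₁ : o₁ ∈ objs ψ) (h₂ : o₂ ∈ objs ψ) {a₁ a₂ : Ref × GridPoint}
    (ha₁ : a₁ ∈ o₁.1.verts) (ha₂ : a₂ ∈ o₂.1.verts)
    (h : gpos ψ (oname ψ o₁ a₁.1) = gpos ψ (oname ψ o₂ a₂.1)) : oname ψ o₁ a₁.1 = oname ψ o₂ a₂.1 := by
  rw [gpos_own hw h₁ ha₁, gpos_own hw h₂ ha₂] at h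
  obtain ⟨rfl, ha⟩ := pos_inj hw h₁ h₂ ha₁ ha₂ h
  rw [ha]

/-! ### The edges of the objects: the local conditions of validity -/

/-- Membership in the drawn vertices. [folklore] -/
theorem mem_dverts_iff {v : ℕ} : v ∈ (drawing ψ).verts ↔ ∃ o ∈ objs ψ, ∃ a ∈ o.1.verts, v = oname ψ o a.1 := by
  show v ∈ (objs ψ).flatMap (overts ψ) ↔ _
  simp only [List.mem_flatMap, overts, Kind.ownKeys, List.map_map, List.mem_map, Function.comp]
  constructor
  · rintro ⟨o, ho, a, ha, rfl⟩; exact ⟨o, ho, a, ha, rfl⟩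
  · rintro ⟨o, ho, a, ha, rfl⟩; exact ⟨o, ho, a, ha, rfl⟩

/-- Membership in the drawn edges of an object. [folklore] -/
theorem mem_oedges_iff {o : Obj} {d : SEdge ℕ} :
    d ∈ oedges ψ o ↔ ∃ e ∈ o.1.wedges, d = (oname ψ o e.1, oname ψ o e.2.1, (poly e.2.2).map (shiftPt (oanchor ψ o))) := by
  simp only [oedges, List.mem_map]
  constructor
  · rintro ⟨e, he, rfl⟩; exact ⟨e, he, rfl⟩
  · rintro ⟨e, he, rfl⟩; exact ⟨e, he, rfl⟩

section objectEdges

variable (hw : WidthOK ψ) (hN : 0 < N ψ)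
include hw hN

/-- The ends of an object edge are drawn vertices, distinct, and the path runs between their
positions; the path is a self-avoiding grid path. [folklore] -/
theorem oedge_wf {o : Obj} (ho : o ∈ objs ψ) {e : Ref × Ref × List GridPoint} (he : e ∈ o.1.wedges) :
    oname ψ o e.1 ∈ (drawing ψ).verts ∧ oname ψ o e.2.1 ∈ (drawing ψ).verts ∧ oname ψ o e.1 ≠ oname ψ o e.2.1 ∧
    ((poly e.2.2).map (shiftPt (oanchor ψ o))).head? = some (gpos ψ (oname ψ o e.1)) ∧
    ((poly e.2.2).map (shiftPt (oanchor ψ o))).getLast? = some (gpos ψ (oname ψ o e.2.1)) ∧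
    ((poly e.2.2).map (shiftPt (oanchor ψ o))).Nodup ∧
    List.IsChain IsGridEdge ((poly e.2.2).map (shiftPt (oanchor ψ o))) := by
  obtain ⟨h1, h2, h3, h4, h5, -, -, h8, h9, -⟩ := edgeWF_of_mem he
  refine ⟨oname_mem_verts hw hN ho h1, oname_mem_verts hw hN ho h2,
    fun h => h3 (oname_inj_posTable hw hN ho h1 h2 h), ?_, ?_, h8.map (shiftPt_injective _), ?_⟩
  · rw [List.head?_map, h4, (end_resolve hw hN ho h1).2]; rfl
  · rw [List.getLast?_map, h5, (end_resolve hw hN ho h2).2]; rfl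
  · exact List.isChain_map_of_isChain _ (fun a b h => SDrawing.isGridEdge_shift h) h9

omit hw hN in
/-- A point common to a drawn vertex and an object edge is an end of the edge (same object).
[folklore] -/
theorem interior_same {o : Obj} {e : Ref × Ref × List GridPoint} (he : e ∈ o.1.wedges)
    {a : Ref × GridPoint} (ha : a ∈ o.1.verts) {q : GridPoint} (hq : q ∈ poly e.2.2) (hpq : a.2 = q) :
    a.2 = o.1.lpos e.1 ∨ a.2 = o.1.lpos e.2.1 := by
  obtain ⟨-, -, -, -, -, h6, h7, -, -, h10⟩ := edgeWF_of_mem he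
  have hpt := (localOK_parts o.1).2.1 a (by rw [Kind.posTable]; exact List.mem_append_left _ ha) e he
  have := ptEdge_sound hpt h10 hq (by rw [hpq]; simp [shiftPt])
  rw [endsOf_eq h6 h7] at this
  simpa [shiftPt] using this

omit hN in
/-- The same, for near distinct objects (vertex of the first, edge of the second). [folklore] -/
theorem interior_near {o₁ o₂ : Obj} (h₁ : o₁ ∈ objs ψ) (h₂ : o₂ ∈ objs ψ) (hne : o₁ ≠ o₂) (hnear : Near o₁ o₂)
    {e : Ref × Ref × List GridPoint} (he : e ∈ o₂.1.wedges) {a : Ref × GridPoint} (ha : a ∈ o₁.1.posTable)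
    {q : GridPoint} (hq : q ∈ poly e.2.2) (h : shiftPt (oanchor ψ o₁) a.2 = shiftPt (oanchor ψ o₂) q) :
    shiftPt (oanchor ψ o₁) a.2 = shiftPt (oanchor ψ o₂) (o₂.1.lpos e.1) ∨
      shiftPt (oanchor ψ o₁) a.2 = shiftPt (oanchor ψ o₂) (o₂.1.lpos e.2.1) := by
  obtain ⟨-, -, -, -, -, h6, h7, -, -, h10⟩ := edgeWF_of_mem he
  have hloc := local_eq_shift_of_global_eq h₁ h₂ h
  rcases compatB_parts (compatB_of_near hw h₁ h₂ hne hnear) with hbox | ⟨-, hpe, -, -⟩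
  · exfalso
    refine ne_of_boxApartB hbox ?_ ?_ hloc
    · exact within_bboxOf_of_mem (List.mem_append_left _ (List.mem_map.2 ⟨a, ha, rfl⟩))
    · -- the bounding box of the corners lies in the bounding box of the kind
      obtain ⟨s, hs, hin⟩ := exists_cseg_of_mem_poly h10 hq
      have hs1 : s.1 ∈ e.2.2 := (List.of_mem_zip hs).1
      have hs2 : s.2 ∈ e.2.2 := List.mem_of_mem_drop (List.of_mem_zip hs).2
      exact within_of_inCseg (within_bboxOf_of_mem (List.mem_append_right _ (List.mem_flatMap.2 ⟨e, he, hs1⟩)))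
        (within_bboxOf_of_mem (List.mem_append_right _ (List.mem_flatMap.2 ⟨e, he, hs2⟩))) hin
  · have := ptEdge_sound (hpe a ha e he) h10 hq hloc
    rw [endsOf_eq h6 h7] at this
    simp only [List.map_cons, List.map_nil, List.mem_cons, List.not_mem_nil, or_false] at this
    rcases this with hh | hh
    · left
      rw [hh, oanchor_eq_shift h₁ h₂]
      simp only [shiftPt, Prod.mk.injEq]; constructor <;> ring
    · right
      rw [hh, oanchor_eq_shift h₁ h₂]
      simp only [shiftPt, Prod.mk.injEq]; constructor <;> ring

end objectEdges

/-! ### Pairs of object edges -/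

section objectEdgePairs

variable (hw : WidthOK ψ) (hN : 0 < N ψ)
include hw hN

omit hw hN in
/-- Two distinct edges of one object meet only at common ends, and never have the same end pair.
[folklore] -/
theorem edges_same {o : Obj} {e e' : Ref × Ref × List GridPoint} (he : e ∈ o.1.wedges) (he' : e' ∈ o.1.wedges)
    (hne : e ≠ e') :
    (∀ p ∈ poly e.2.2, p ∈ poly e'.2.2 → p = o.1.lpos e.1 ∨ p = o.1.lpos e.2.1) ∧
    ¬ (e.1 = e'.1 ∧ e.2.1 = e'.2.1) ∧ ¬ (e.1 = e'.2.1 ∧ e.2.1 = e'.1) := by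
  obtain ⟨-, -, -, -, -, h6, h7, -, -, h10⟩ := edgeWF_of_mem he
  obtain ⟨-, -, -, -, -, -, -, -, -, h10'⟩ := edgeWF_of_mem he'
  obtain ⟨hee, hs1, hs2⟩ := (localOK_parts o.1).2.2 e he e' he' hne
  refine ⟨fun p hp hq => ?_, hs1, hs2⟩
  have := (edgeEdge_sound hee h10 h10' hp hq (by simp [shiftPt])).1
  rw [endsOf_eq h6 h7] at this
  simpa using this

omit hN in
/-- Edges of near distinct objects meet only at common ends and never have the same end pair (up to
re-anchoring); far ones do not meet. [folklore] -/
theorem edges_other {o₁ o₂ : Obj} (h₁ : o₁ ∈ objs ψ) (h₂ : o₂ ∈ objs ψ) (hne : o₁ ≠ o₂)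
    {e e' : Ref × Ref × List GridPoint} (he : e ∈ o₁.1.wedges) (he' : e' ∈ o₂.1.wedges) :
    (∀ p ∈ poly e.2.2, ∀ q ∈ poly e'.2.2, shiftPt (oanchor ψ o₁) p = shiftPt (oanchor ψ o₂) q →
      p = o₁.1.lpos e.1 ∨ p = o₁.1.lpos e.2.1) ∧
    (Near o₁ o₂ → boxApartB o₁.1.bbox o₂.1.bbox (Kind.shiftOf (offs o₁ o₂)) = true ∨
      (¬ (e.1 = Kind.reRef (offs o₁ o₂) e'.1 ∧ e.2.1 = Kind.reRef (offs o₁ o₂) e'.2.1) ∧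
       ¬ (e.1 = Kind.reRef (offs o₁ o₂) e'.2.1 ∧ e.2.1 = Kind.reRef (offs o₁ o₂) e'.1))) := by
  obtain ⟨-, -, -, -, -, h6, h7, -, -, h10⟩ := edgeWF_of_mem he
  obtain ⟨-, -, -, -, -, -, -, -, -, h10'⟩ := edgeWF_of_mem he'
  -- corners of the paths lie in the bounding boxes of their kinds
  have hbb : ∀ {κ : Kind} {f : Ref × Ref × List GridPoint}, f ∈ κ.wedges → 2 ≤ f.2.2.length →
      ∀ q ∈ poly f.2.2, WithinB κ.bbox q := by
    intro κ f hf hlen q hq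
    obtain ⟨s, hs, hin⟩ := exists_cseg_of_mem_poly hlen hq
    have hs1 : s.1 ∈ f.2.2 := (List.of_mem_zip hs).1
    have hs2 : s.2 ∈ f.2.2 := List.mem_of_mem_drop (List.of_mem_zip hs).2
    exact within_of_inCseg (within_bboxOf_of_mem (List.mem_append_right _ (List.mem_flatMap.2 ⟨f, hf, hs1⟩)))
      (within_bboxOf_of_mem (List.mem_append_right _ (List.mem_flatMap.2 ⟨f, hf, hs2⟩))) hin
  by_cases hnear : Near o₁ o₂
  · rcases compatB_parts (compatB_of_near hw h₁ h₂ hne hnear) with hbox | ⟨-, -, -, hee⟩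
    · refine ⟨fun p hp q hq h => ?_, fun _ => Or.inl hbox⟩
      exact absurd (local_eq_shift_of_global_eq h₁ h₂ h) (ne_of_boxApartB hbox (hbb he h10 p hp) (hbb he' h10' q hq))
    · obtain ⟨hee, hs1, hs2⟩ := hee e he e' he'
      refine ⟨fun p hp q hq h => ?_, fun _ => Or.inr ⟨hs1, hs2⟩⟩
      have := (edgeEdge_sound hee h10 h10' hp hq (local_eq_shift_of_global_eq h₁ h₂ h)).1
      rw [endsOf_eq h6 h7] at this
      simpa using this
  · refine ⟨fun p hp q hq h => ?_, fun h => absurd h hnear⟩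
    exact absurd h (ne_of_far h₁ h₂ hnear (inBox_of_mem_poly he hp) (inBox_of_mem_poly he' hq))

omit hw hN in
/-- The local position of a listed reference is a listed position, hence in the kind's box.
[folklore] -/
theorem within_bbox_lpos {κ : Kind} {r : Ref} (hr : r ∈ (κ.posTable).map Prod.fst) : WithinB κ.bbox (κ.lpos r) := by
  obtain ⟨a, ha, har⟩ := List.mem_map.1 hr
  have : κ.lpos r = a.2 := by
    rw [← har]
    rw [Kind.posTable, List.mem_append] at ha
    rcases ha with ha | ha
    exacts [lpos_of_mem_verts ha, lpos_of_mem_phantoms ha]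
  rw [this]
  exact within_bboxOf_of_mem (List.mem_append_left _ (List.mem_map.2 ⟨a, ha, rfl⟩))

/-- **No two object edges with the same end pair** (the end names equal in order). [folklore] -/
theorem not_sameEnds {o₁ o₂ : Obj} (h₁ : o₁ ∈ objs ψ) (h₂ : o₂ ∈ objs ψ) {e e' : Ref × Ref × List GridPoint}
    (he : e ∈ o₁.1.wedges) (he' : e' ∈ o₂.1.wedges) (hne : o₁ ≠ o₂ ∨ e ≠ e')
    (ha : oname ψ o₁ e.1 = oname ψ o₂ e'.1) (hb : oname ψ o₁ e.2.1 = oname ψ o₂ e'.2.1) : False := by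
  obtain ⟨hr1, hr2, -⟩ := edgeWF_of_mem he
  obtain ⟨hr1', hr2', -⟩ := edgeWF_of_mem he'
  by_cases ho : o₁ = o₂
  · subst ho
    have hee : e ≠ e' := by rcases hne with h | h; exacts [absurd rfl h, h]
    obtain ⟨-, hs1, -⟩ := edges_same (o := o₁) he he' hee
    exact hs1 ⟨oname_inj_posTable hw hN h₁ hr1 hr1' ha, oname_inj_posTable hw hN h₁ hr2 hr2' hb⟩
  · have hea := eq_reRef_of_oname_eq hw hN h₁ h₂ hr1 hr1' ha
    have heb := eq_reRef_of_oname_eq hw hN h₁ h₂ hr2 hr2' hb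
    by_cases hnear : Near o₁ o₂
    · rcases (edges_other hw h₁ h₂ ho he he').2 hnear with hbox | ⟨hs1, -⟩
      · -- apart boxes: but the first ends sit at one point
        have hp : gpos ψ (oname ψ o₁ e.1) = gpos ψ (oname ψ o₂ e'.1) := by rw [ha]
        rw [(end_resolve hw hN h₁ hr1).2, (end_resolve hw hN h₂ hr1').2] at hp
        refine ne_of_boxApartB hbox ?_ ?_ (local_eq_shift_of_global_eq h₁ h₂ hp)
        · exact within_bbox_lpos hr1
        · exact within_bbox_lpos hr1'
      · exact hs1 ⟨hea, heb⟩
    · have hp : gpos ψ (oname ψ o₁ e.1) = gpos ψ (oname ψ o₂ e'.1) := by rw [ha]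
      rw [(end_resolve hw hN h₁ hr1).2, (end_resolve hw hN h₂ hr1').2] at hp
      exact ne_of_far h₁ h₂ hnear (inBox_lpos hr1) (inBox_lpos hr1') hp

/-- The same with the ends crossed. [folklore] -/
theorem not_sameEnds' {o₁ o₂ : Obj} (h₁ : o₁ ∈ objs ψ) (h₂ : o₂ ∈ objs ψ) {e e' : Ref × Ref × List GridPoint}
    (he : e ∈ o₁.1.wedges) (he' : e' ∈ o₂.1.wedges) (hne : o₁ ≠ o₂ ∨ e ≠ e')
    (ha : oname ψ o₁ e.1 = oname ψ o₂ e'.2.1) (hb : oname ψ o₁ e.2.1 = oname ψ o₂ e'.1) : False := by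
  obtain ⟨hr1, hr2, -⟩ := edgeWF_of_mem he
  obtain ⟨hr1', hr2', -⟩ := edgeWF_of_mem he'
  by_cases ho : o₁ = o₂
  · subst ho
    have hee : e ≠ e' := by rcases hne with h | h; exacts [absurd rfl h, h]
    obtain ⟨-, -, hs2⟩ := edges_same (o := o₁) he he' hee
    exact hs2 ⟨oname_inj_posTable hw hN h₁ hr1 hr2' ha, oname_inj_posTable hw hN h₁ hr2 hr1' hb⟩
  · have hea := eq_reRef_of_oname_eq hw hN h₁ h₂ hr1 hr2' ha
    have heb := eq_reRef_of_oname_eq hw hN h₁ h₂ hr2 hr1' hb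
    by_cases hnear : Near o₁ o₂
    · rcases (edges_other hw h₁ h₂ ho he he').2 hnear with hbox | ⟨-, hs2⟩
      · have hp : gpos ψ (oname ψ o₁ e.1) = gpos ψ (oname ψ o₂ e'.2.1) := by rw [ha]
        rw [(end_resolve hw hN h₁ hr1).2, (end_resolve hw hN h₂ hr2').2] at hp
        refine ne_of_boxApartB hbox ?_ ?_ (local_eq_shift_of_global_eq h₁ h₂ hp)
        · exact within_bbox_lpos hr1
        · exact within_bbox_lpos hr2'
      · exact hs2 ⟨hea, heb⟩
    · have hp : gpos ψ (oname ψ o₁ e.1) = gpos ψ (oname ψ o₂ e'.2.1) := by rw [ha]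
      rw [(end_resolve hw hN h₁ hr1).2, (end_resolve hw hN h₂ hr2').2] at hp
      exact ne_of_far h₁ h₂ hnear (inBox_lpos hr1) (inBox_lpos hr2') hp

/-- **A common point of two object edges is a drawn vertex.** [folklore] -/
theorem common_point_is_vertex {o₁ o₂ : Obj} (h₁ : o₁ ∈ objs ψ) (h₂ : o₂ ∈ objs ψ) {e e' : Ref × Ref × List GridPoint}
    (he : e ∈ o₁.1.wedges) (he' : e' ∈ o₂.1.wedges) (hne : o₁ ≠ o₂ ∨ e ≠ e')
    {p q : GridPoint} (hp : p ∈ poly e.2.2) (hq : q ∈ poly e'.2.2) (h : shiftPt (oanchor ψ o₁) p = shiftPt (oanchor ψ o₂) q) :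
    ∃ v ∈ (drawing ψ).verts, (drawing ψ).pos v = shiftPt (oanchor ψ o₁) p := by
  obtain ⟨hr1, hr2, -⟩ := edgeWF_of_mem he
  have hend : p = o₁.1.lpos e.1 ∨ p = o₁.1.lpos e.2.1 := by
    by_cases ho : o₁ = o₂
    · subst ho
      have hee : e ≠ e' := by rcases hne with h | h; exacts [absurd rfl h, h]
      exact (edges_same (o := o₁) he he' hee).1 p hp (by rwa [shiftPt_oanchor_inj h])
    · exact (edges_other hw h₁ h₂ ho he he').1 p hp q hq h
  rcases hend with rfl | rfl
  · exact ⟨_, oname_mem_verts hw hN h₁ hr1, (end_resolve hw hN h₁ hr1).2⟩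
  · exact ⟨_, oname_mem_verts hw hN h₁ hr2, (end_resolve hw hN h₁ hr2).2⟩

/-- **A drawn vertex on an object edge is one of its ends.** [folklore] -/
theorem vertex_on_edge {o o' : Obj} (ho : o ∈ objs ψ) (ho' : o' ∈ objs ψ) {e : Ref × Ref × List GridPoint}
    (he : e ∈ o.1.wedges) {a : Ref × GridPoint} (ha : a ∈ o'.1.verts) {q : GridPoint} (hq : q ∈ poly e.2.2)
    (h : shiftPt (oanchor ψ o') a.2 = shiftPt (oanchor ψ o) q) :
    oname ψ o' a.1 = oname ψ o e.1 ∨ oname ψ o' a.1 = oname ψ o e.2.1 := by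
  obtain ⟨hr1, hr2, -⟩ := edgeWF_of_mem he
  -- the vertex sits at the position of an end
  have hend : shiftPt (oanchor ψ o') a.2 = shiftPt (oanchor ψ o) (o.1.lpos e.1) ∨
      shiftPt (oanchor ψ o') a.2 = shiftPt (oanchor ψ o) (o.1.lpos e.2.1) := by
    by_cases hoo : o' = o
    · subst hoo
      rcases interior_same he ha hq (shiftPt_oanchor_inj h) with hh | hh <;> [left; right] <;> rw [hh]
    · by_cases hnear : Near o' o
      · exact interior_near hw ho' ho hoo hnear he (by rw [Kind.posTable]; exact List.mem_append_left _ ha) hq h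
      · exact absurd h (ne_of_far ho' ho hnear (inBox_of_mem_verts ha) (inBox_of_mem_poly he hq))
  -- ends are drawn own vertices; positions determine names
  have key : ∀ {r : Ref}, r ∈ (o.1.posTable).map Prod.fst →
      shiftPt (oanchor ψ o') a.2 = shiftPt (oanchor ψ o) (o.1.lpos r) → oname ψ o' a.1 = oname ψ o r := by
    intro r hr hh
    obtain ⟨⟨o₂, ho₂, a₂, ha₂, hname, -⟩, hpos⟩ := end_resolve hw hN ho hr
    rw [hname]
    refine name_eq_of_pos_eq hw ho' ho₂ ha ha₂ ?_
    rw [← hname, hpos, gpos_own hw ho' ha, hh]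
  rcases hend with hh | hh
  · exact Or.inl (key hr1 hh)
  · exact Or.inr (key hr2 hh)

end objectEdgePairs

/-! ### Bounds of the picture -/

/-- A local point of a kind: a listed position or a point of one of its paths. [folklore] -/
def IsLocalPt (κ : Kind) (q : GridPoint) : Prop :=
  q ∈ (κ.posTable).map Prod.snd ∨ ∃ e ∈ κ.wedges, q ∈ poly e.2.2

/-- Reading the extent check. [folklore] -/
theorem extent_of_mem {b : BSpec} {κ : Kind} (hκ : κ ∈ b.bundle) {p : GridPoint} (hp : p ∈ κ.cornersAndPos) :
    (p.1 ≤ 107 ∨ (b.eastish = true ∧ p.1 ≤ 224) ∨ (b.or3head = true ∧ p.1 ≤ 341)) ∧ -10 ≤ p.1 ∧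
    (b = .doubler → 85 ≤ p.1) ∧ -27 ≤ p.2 ∧ (b.isClause = true → -10 ≤ p.2) ∧ p.2 ≤ 160 := by
  have := extent_bundle
  simp only [List.all_eq_true, Bool.and_eq_true, Bool.or_eq_true, decide_eq_true_eq, Bool.not_eq_true',
    decide_eq_false_iff_not] at this
  obtain ⟨⟨⟨⟨⟨h1, h2⟩, h3⟩, h4⟩, h5⟩, h6⟩ := this b (BSpec.mem_all b) κ hκ p hp
  refine ⟨?_, h2, fun hb => ?_, h4, fun hc => ?_, h6⟩
  · rcases h1 with (h | h) | h
    exacts [Or.inl h, Or.inr (Or.inl h), Or.inr (Or.inr h)]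
  · rcases h3 with h | h
    exacts [absurd hb h, h]
  · rcases h5 with h | h
    · rw [h] at hc; exact absurd hc Bool.false_ne_true
    · exact h

/-- **Local points lie between corners**: the extent bounds hold for every local point. [folklore] -/
theorem extent_local {b : BSpec} {κ : Kind} (hκ : κ ∈ b.bundle) {q : GridPoint} (hq : IsLocalPt κ q) :
    (q.1 ≤ 107 ∨ (b.eastish = true ∧ q.1 ≤ 224) ∨ (b.or3head = true ∧ q.1 ≤ 341)) ∧ -10 ≤ q.1 ∧
    (b = .doubler → 85 ≤ q.1) ∧ -27 ≤ q.2 ∧ (b.isClause = true → -10 ≤ q.2) ∧ q.2 ≤ 160 := by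
  rcases hq with hq | ⟨e, he, hq⟩
  · exact extent_of_mem hκ (List.mem_append_left _ hq)
  · rcases mem_poly_exists hq with ⟨a, c, hac, hin⟩ | h
    · have ha := extent_of_mem hκ (List.mem_append_right _ (List.mem_flatMap.2 ⟨e, he, hac.subset (show a ∈ [a, c] by simp)⟩))
      have hc := extent_of_mem hκ (List.mem_append_right _ (List.mem_flatMap.2 ⟨e, he, hac.subset (show c ∈ [a, c] by simp)⟩))
      rw [inCseg_iff] at hin
      refine ⟨?_, by omega, fun hb => by have := ha.2.2.1 hb; have := hc.2.2.1 hb; omega, by omega,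
        fun hb => by have := ha.2.2.2.2.1 hb; have := hc.2.2.2.2.1 hb; omega, by omega⟩
      rcases ha.1 with ha1 | ⟨hb, ha1⟩ | ⟨hb, ha1⟩ <;> rcases hc.1 with hc1 | ⟨hb', hc1⟩ | ⟨hb', hc1⟩
      all_goals first
        | exact Or.inl (by omega)
        | exact Or.inr (Or.inl ⟨‹b.eastish = true›, by omega⟩)
        | exact Or.inr (Or.inr ⟨‹b.or3head = true›, by omega⟩)
    · exact extent_of_mem hκ (List.mem_append_right _ (List.mem_flatMap.2 ⟨e, he, by rw [h]; simp⟩))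

/-- The parameters of an actual object's tile and its flags. [folklore] -/
theorem bspec_flags {κ : Kind} {i jj : ℕ} (ho : ((κ, i, jj) : Obj) ∈ objs ψ) (hw : WidthOK ψ) (hN : 0 < N ψ) :
    ((bspecAt ψ i jj).eastish = true → jj + 1 ≤ N ψ) ∧
    ((bspecAt ψ i jj).or3head = true → jj + 2 ≤ N ψ) ∧
    (bspecAt ψ i jj = .doubler ↔ jj = 0) ∧
    ((bspecAt ψ i jj).isClause = true ↔ (i = V ψ ∧ 1 ≤ jj)) ∧
    i ≤ V ψ ∧ jj ≤ N ψ := by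
  obtain ⟨ht, -⟩ := (mem_objs_iff ψ).1 ho
  simp only at ht
  have hti := (mem_tcoords_iff ψ (t := (i, jj))).1 ht
  simp only [Prod.mk.injEq] at hti
  refine ⟨fun h => ?_, fun h => ?_, ?_, ?_, by omega, by omega⟩
  · rcases tile_classes ht with ⟨rfl, rfl, hb⟩ | ⟨hi, hj, hj', hb⟩ | ⟨hi, hj, hj', hV, hb⟩ <;> rw [hb] at h <;>
      simp [BSpec.eastish] at h <;> omega
  · rcases tile_classes ht with ⟨rfl, rfl, hb⟩ | ⟨hi, hj, hj', hb⟩ | ⟨hi, hj, hj', hV, hb⟩ <;> rw [hb] at h <;>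
      simp [BSpec.or3head] at h
    have := lt_N_of_roleOf_or3a hw (show jj - 1 < N ψ by omega) h.1; omega
  · rcases tile_classes ht with ⟨rfl, rfl, hb⟩ | ⟨hi, hj, hj', hb⟩ | ⟨hi, hj, hj', hV, hb⟩ <;> rw [hb] <;> simp <;> omega
  · rcases tile_classes ht with ⟨rfl, rfl, hb⟩ | ⟨hi, hj, hj', hb⟩ | ⟨hi, hj, hj', hV, hb⟩ <;> rw [hb] <;>
      simp [BSpec.isClause] <;> omega

/-- **The global abscissa of every point of the picture** is at most `4V + 40 + 117·N + 107` (the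
corner `Q` of the last cell of a row) and at least `4V + 40 + 85`. [folklore] -/
theorem global_x_bounds (hw : WidthOK ψ) (hN : 0 < N ψ) {o : Obj} (ho : o ∈ objs ψ) {q : GridPoint} (hq : IsLocalPt o.1 q) :
    (shiftPt (oanchor ψ o) q).1 ≤ ((4 * V ψ + 40 + 117 * N ψ + 107 : ℕ) : ℤ) ∧
      ((4 * V ψ + 40 + 85 : ℕ) : ℤ) ≤ (shiftPt (oanchor ψ o) q).1 := by
  obtain ⟨κ, i, jj⟩ := o
  obtain ⟨he, hor, hd, -, -, hjj⟩ := bspec_flags ho hw hN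
  have hb := ((mem_objs_iff ψ).1 ho).2
  simp only at hb hq
  obtain ⟨h1, h2, h3, -⟩ := extent_local hb hq
  simp only [shiftPt, oanchor, anchor]
  push_cast
  constructor
  · rcases h1 with h | ⟨hE, h⟩ | ⟨hO, h⟩
    · have : (jj : ℤ) ≤ N ψ := by exact_mod_cast hjj
      nlinarith
    · have : (jj : ℤ) + 1 ≤ N ψ := by exact_mod_cast he hE
      nlinarith
    · have : (jj : ℤ) + 2 ≤ N ψ := by exact_mod_cast hor hO
      nlinarith
  · by_cases hj0 : jj = 0
    · have := h3 (hd.2 hj0); subst hj0; push_cast; omega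
    · have : (1 : ℤ) ≤ jj := by exact_mod_cast Nat.one_le_iff_ne_zero.2 hj0
      nlinarith

/-- **The global ordinate of every point of the picture** is at least `4V + 10`. [folklore] -/
theorem global_y_bound (hN : 0 < N ψ) {o : Obj} (ho : o ∈ objs ψ) {q : GridPoint} (hq : IsLocalPt o.1 q) :
    ((4 * V ψ + 10 : ℕ) : ℤ) ≤ (shiftPt (oanchor ψ o) q).2 := by
  obtain ⟨κ, i, jj⟩ := o
  obtain ⟨ht, hb⟩ := (mem_objs_iff ψ).1 ho
  simp only at ht hb hq
  have hV : 0 < V ψ := V_pos_of_N_pos ψ hN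
  simp only [shiftPt, oanchor, anchor]
  push_cast
  rcases tile_classes ht with ⟨rfl, rfl, hb'⟩ | ⟨hi, hj, hj', hb'⟩ | ⟨hi, hj, hj', -, hb'⟩
  · obtain ⟨-, -, -, h4, -⟩ := extent_local hb hq
    have : ((V ψ - 0 : ℕ) : ℤ) ≥ 1 := by exact_mod_cast (show 1 ≤ V ψ - 0 by omega)
    nlinarith
  · obtain ⟨-, -, -, h4, -⟩ := extent_local hb hq
    have : ((V ψ - i : ℕ) : ℤ) ≥ 1 := by exact_mod_cast (show 1 ≤ V ψ - i by omega)
    nlinarith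
  · subst hi
    rw [hb'] at hb
    obtain ⟨-, -, -, -, h5, -⟩ := extent_local hb hq
    have := h5 rfl
    simp only [Nat.sub_self, Nat.cast_zero, mul_zero, add_zero]
    omega

/-! ### Return paths: geometry -/

/-- The corners of the return path of row `i`, spelled out. [folklore] -/
theorem retCorners_eq (i : ℕ) : retCorners ψ i =
    [(((4 * V ψ + 40 + 117 * N ψ : ℕ) : ℤ) + 107, ((4 * V ψ + 20 + 160 * (V ψ - i) : ℕ) : ℤ)),
     (((4 * V ψ + 40 + 117 * (N ψ + 1) + 4 + 4 * (V ψ - i) : ℕ) : ℤ), ((4 * V ψ + 20 + 160 * (V ψ - i) : ℕ) : ℤ)),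
     (((4 * V ψ + 40 + 117 * (N ψ + 1) + 4 + 4 * (V ψ - i) : ℕ) : ℤ), ((2 + 4 * i : ℕ) : ℤ)),
     (((2 + 4 * i : ℕ) : ℤ), ((2 + 4 * i : ℕ) : ℤ)),
     (((2 + 4 * i : ℕ) : ℤ), ((4 * V ψ + 20 + 160 * (V ψ - (i + 1)) : ℕ) : ℤ)),
     (((4 * V ψ + 40 + 117 * 1 : ℕ) : ℤ) + 15, ((4 * V ψ + 20 + 160 * (V ψ - (i + 1)) : ℕ) : ℤ))] := by
  simp [retCorners, anchor]

/-- **The points of a return path** lie on one of its five segments. [folklore] -/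
theorem ret_mem_cases {i : ℕ} (hi : i < V ψ) {p : GridPoint} (hp : p ∈ poly (retCorners ψ i)) :
    let A : ℤ := ((4 * V ψ + 40 + 117 * N ψ : ℕ) : ℤ) + 107
    let Y : ℤ := (4 * V ψ + 20 + 160 * (V ψ - i) : ℕ)
    let XR : ℤ := (4 * V ψ + 40 + 117 * (N ψ + 1) + 4 + 4 * (V ψ - i) : ℕ)
    let B : ℤ := (2 + 4 * i : ℕ)
    let Y' : ℤ := (4 * V ψ + 20 + 160 * (V ψ - (i + 1)) : ℕ)
    let C : ℤ := ((4 * V ψ + 40 + 117 * 1 : ℕ) : ℤ) + 15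
    (p.2 = Y ∧ A ≤ p.1 ∧ p.1 ≤ XR) ∨ (p.1 = XR ∧ B ≤ p.2 ∧ p.2 ≤ Y) ∨ (p.2 = B ∧ B ≤ p.1 ∧ p.1 ≤ XR) ∨
      (p.1 = B ∧ B ≤ p.2 ∧ p.2 ≤ Y') ∨ (p.2 = Y' ∧ B ≤ p.1 ∧ p.1 ≤ C) := by
  intro A Y XR B Y' C
  rw [retCorners_eq] at hp
  have hV : (V ψ - i : ℕ) = (V ψ - (i + 1) : ℕ) + 1 := by omega
  rcases mem_poly_exists hp with ⟨a, b, hab, hin⟩ | h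
  · have hcs := mem_csegs_of_infix hab
    simp only [csegs, List.drop_succ_cons, List.drop_zero, List.zip_cons_cons, List.zip_nil_right, List.mem_cons,
      Prod.mk.injEq, List.not_mem_nil, or_false] at hcs
    rw [inCseg_iff] at hin
    rcases hcs with ⟨rfl, rfl⟩ | ⟨rfl, rfl⟩ | ⟨rfl, rfl⟩ | ⟨rfl, rfl⟩ | ⟨rfl, rfl⟩ <;> simp only at hin <;> push_cast at hin ⊢ <;>
      omega
  · simp at h

/-- Reading the west corridor check. [folklore] -/
theorem westCorridor_of_mem {b : BSpec} (hb : b.westOpen = true) {κ : Kind} (hκ : κ ∈ b.bundle) :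
    (∀ a ∈ κ.posTable, ¬ (a.2.2 = 0 ∧ a.2.1 < 15)) ∧ (∀ s ∈ κ.allSegs, segHitsB 0 15 s = false) := by
  have := westCorridor_bundle
  simp only [List.all_eq_true, Bool.or_eq_true, Bool.not_eq_true', Bool.and_eq_true, decide_eq_true_eq,
    Bool.and_eq_false_imp, decide_eq_false_iff_not] at this
  rcases this b (BSpec.mem_all b) with h | h
  · rw [h] at hb; exact absurd hb Bool.false_ne_true
  · obtain ⟨h1, h2⟩ := h κ hκ
    exact ⟨fun a ha hh => h1 a ha hh.1 hh.2, fun s hs => by simpa using h2 s hs⟩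

/-- Reading the top corridor check. [folklore] -/
theorem topCorridor_of (κ : Kind) :
    (∀ a ∈ κ.posTable, ¬ (a.2.2 = 160 ∧ a.2.1 < 15)) ∧ (∀ s ∈ κ.allSegs, segHitsB 160 15 s = false) := by
  have := topCorridor_all κ
  simp only [List.all_eq_true, Bool.and_eq_true, Bool.not_eq_true', Bool.and_eq_false_imp, decide_eq_true_eq,
    decide_eq_false_iff_not] at this
  exact ⟨fun a ha hh => this.1 a ha hh.1 hh.2, fun s hs => by simpa using this.2 s hs⟩

/-- A local point in a corridor region forces a listed position or a segment into it. [folklore] -/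
theorem corridor_contra {κ : Kind} {y₀ : ℤ} (hpos : ∀ a ∈ κ.posTable, ¬ (a.2.2 = y₀ ∧ a.2.1 < 15))
    (hseg : ∀ s ∈ κ.allSegs, segHitsB y₀ 15 s = false) {q : GridPoint} (hq : IsLocalPt κ q) (hy : q.2 = y₀) (hx : q.1 < 15) :
    False := by
  rcases hq with hq | ⟨e, he, hq⟩
  · obtain ⟨a, ha, rfl⟩ := List.mem_map.1 hq
    exact hpos a ha ⟨hy, hx⟩
  · obtain ⟨-, -, -, -, -, -, -, -, -, h10⟩ := edgeWF_of_mem he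
    obtain ⟨s, hs, hin⟩ := exists_cseg_of_mem_poly h10 hq
    have := hseg s (List.mem_flatMap.2 ⟨e, he, hs⟩)
    rw [inCseg_iff] at hin
    simp only [segHitsB, Bool.and_eq_false_iff, decide_eq_false_iff_not] at this
    omega

/-- **A point of the picture on a return path is one of the two ends of the path.** [folklore] -/
theorem object_pt_on_ret (hw : WidthOK ψ) (hN : 0 < N ψ) {o : Obj} (ho : o ∈ objs ψ) {q : GridPoint} (hq : IsLocalPt o.1 q)
    {i : ℕ} (hi : i < V ψ) (hp : shiftPt (oanchor ψ o) q ∈ poly (retCorners ψ i)) :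
    shiftPt (oanchor ψ o) q = (((4 * V ψ + 40 + 117 * N ψ : ℕ) : ℤ) + 107, ((4 * V ψ + 20 + 160 * (V ψ - i) : ℕ) : ℤ)) ∨
    shiftPt (oanchor ψ o) q = (((4 * V ψ + 40 + 117 * 1 : ℕ) : ℤ) + 15, ((4 * V ψ + 20 + 160 * (V ψ - (i + 1)) : ℕ) : ℤ)) := by
  have hx := global_x_bounds hw hN ho hq
  have hy := global_y_bound hN ho hq
  have hcases := ret_mem_cases hi hp
  simp only at hcases
  obtain ⟨κ, io, jjo⟩ := o
  obtain ⟨ht, hb⟩ := (mem_objs_iff ψ).1 ho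
  simp only at ht hb hq hp hx hy ⊢
  have hti := (mem_tcoords_iff ψ (t := (io, jjo))).1 ht
  simp only [Prod.mk.injEq] at hti
  obtain ⟨-, h2, h3, h4, -, h6⟩ := extent_local hb hq
  have hV : (V ψ - i : ℕ) = (V ψ - (i + 1) : ℕ) + 1 := by omega
  simp only [shiftPt, oanchor, anchor, Prod.mk.injEq] at hx hy hcases ⊢
  push_cast at hx hy hcases ⊢
  rcases hcases with ⟨h1, h1', -⟩ | ⟨h1, -⟩ | ⟨h1, -⟩ | ⟨h1, -⟩ | ⟨h1, hxl, hxc⟩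
  · -- along the row of `Q`, to its east: only `Q` itself
    left; constructor <;> omega
  · -- the right vertical is east of everything
    exfalso; omega
  · -- the bottom run is below everything
    exfalso
    have : (i : ℤ) + 1 ≤ V ψ := by exact_mod_cast hi
    omega
  · -- the left vertical is west of everything
    exfalso; omega
  · -- the final run into the connector of the next row
    -- which row and which local ordinate?
    have hiV : io ≤ V ψ := by omega
    have hq2 : q.2 = 160 * ((io : ℤ) - i - 1) := by
      have e1 : ((V ψ - io : ℕ) : ℤ) = (V ψ : ℤ) - io := by push_cast [Nat.cast_sub hiV]; ring
      have e2 : ((V ψ - (i + 1) : ℕ) : ℤ) = (V ψ : ℤ) - (i + 1) := by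
        rw [Nat.cast_sub (by omega)]; push_cast; ring
      rw [e1, e2] at h1; linarith
    have hio : (io = i + 1 ∧ q.2 = 0) ∨ (io = i + 2 ∧ q.2 = 160) := by
      have hq2' : -27 ≤ q.2 ∧ q.2 ≤ 160 := ⟨h4, h6⟩
      rcases lt_trichotomy (io : ℤ) (i + 1) with hlt | heq | hgt
      · exfalso; nlinarith
      · left; exact ⟨by exact_mod_cast heq, by rw [hq2, heq]; ring⟩
      · rcases lt_trichotomy (io : ℤ) (i + 2) with hlt' | heq' | hgt'
        · exfalso; omega
        · right; exact ⟨by exact_mod_cast heq', by rw [hq2, heq']; ring⟩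
        · exfalso; nlinarith
    -- the column: `jj = 1`
    have hjj : jjo = 1 := by
      rcases Nat.lt_or_ge jjo 1 with h | h
      · -- the doubler's tile is in row 0
        exfalso
        have : jjo = 0 := by omega
        subst this
        rcases hti with ⟨h0, -⟩ | ⟨-, h1, -⟩
        · rcases hio with ⟨h', -⟩ | ⟨h', -⟩ <;> omega
        · omega
      · rcases Nat.lt_or_ge jjo 2 with h' | h'
        · omega
        · exfalso
          have : (2 : ℤ) ≤ jjo := by exact_mod_cast h'
          nlinarith
    subst hjj
    have hx15 : q.1 ≤ 15 := by push_cast at hxc; omega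
    rcases hx15.lt_or_eq with hlt | heq
    · exfalso
      rcases hio with ⟨rfl, hq0⟩ | ⟨rfl, hq160⟩
      · -- the next row's first tile is open to the west
        have hopen : (bspecAt ψ (i + 1) 1).westOpen = true := by
          rcases tile_classes ht with ⟨h0, -, -⟩ | ⟨-, -, -, hb'⟩ | ⟨-, -, -, -, hb'⟩
          · omega
          · rw [hb']; simp [BSpec.westOpen]
          · rw [hb']; simp [BSpec.westOpen]
        obtain ⟨hpos, hseg⟩ := westCorridor_of_mem hopen hb
        exact corridor_contra hpos hseg hq hq0 hlt
      · obtain ⟨hpos, hseg⟩ := topCorridor_of κ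
        exact corridor_contra hpos hseg hq hq160 hlt
    · right
      rcases hio with ⟨rfl, hq0⟩ | ⟨rfl, hq160⟩
      · constructor
        · rw [heq]; ring
        · rw [hq0]; ring
      · constructor
        · rw [heq]; ring
        · rw [hq160]
          have : ((V ψ - (i + 2) : ℕ) : ℤ) + 1 = ((V ψ - (i + 1) : ℕ) : ℤ) := by
            have : i + 2 ≤ V ψ := by omega
            omega
          linarith

/-! ### Return paths: ends, self-avoidance, mutual disjointness -/

/-- The points of a rectilinear path: the first corner, or on the box of a listed corner pair.
[folklore] -/
theorem mem_poly_csegs {ws : List GridPoint} {p : GridPoint} (hp : p ∈ poly ws) :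
    ws.head? = some p ∨ ∃ s ∈ csegs ws, inCseg s.1 s.2 p = true := by
  rcases mem_poly_exists hp with ⟨a, b, hab, hin⟩ | h
  · exact Or.inr ⟨(a, b), mem_csegs_of_infix hab, hin⟩
  · left; rw [h]; rfl

/-- The last point of a rectilinear path is its last corner. [folklore] -/
theorem getLast?_poly (ws : List GridPoint) : (poly ws).getLast? = ws.getLast? := by
  suffices h : ∀ (ws' : List GridPoint) (c : GridPoint), (c :: poly.go c ws').getLast? = (c :: ws').getLast? by
    cases ws with
    | nil => rfl
    | cons c ws' => exact h ws' c
  intro ws'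
  induction ws' with
  | nil => intro c; rfl
  | cons d ws' ih =>
    intro c
    have e : c :: poly.go c (d :: ws') = (c :: seg c d) ++ poly.go d ws' := rfl
    rw [e, List.getLast?_append, List.getLast?_cons_cons]
    have ih' := ih d
    cases hgo : poly.go d ws' with
    | nil =>
      rw [hgo] at ih'
      simp only [List.getLast?_singleton] at ih'
      rw [List.getLast?_nil, Option.none_or, ← ih', List.getLast?_eq_some_getLast (by simp)]
      by_cases hs : seg c d = []
      · simp only [hs, List.getLast_singleton, Option.some.injEq]; exact seg_eq_nil_iff.1 hs
      · rw [List.getLast_cons hs, getLast_seg hs]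
    | cons z zs =>
      rw [hgo] at ih'
      rw [← ih', List.getLast?_cons_cons, List.getLast?_eq_some_getLast (l := z :: zs) (by simp), Option.some_or]

/-- A two-corner path is self-avoiding. [folklore] -/
theorem nodup_poly_pair (a b : GridPoint) : (poly [a, b]).Nodup := by
  show (a :: (seg a b ++ [])).Nodup
  rw [List.append_nil, List.nodup_cons]
  exact ⟨start_notMem_seg a b, nodup_seg a b⟩

section retGeometry

variable (hN : 0 < N ψ) {i : ℕ} (hi : i < V ψ)
include hN hi

omit hN hi in
/-- A six-corner staircase around a picture is self-avoiding. [folklore] -/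
theorem nodup_staircase {A XR Y B Y' C : ℤ} (f1 : B < C) (f2 : C < A) (f3 : A < XR) (f4 : B < Y') (f5 : Y' < Y) :
    (poly [(A, Y), (XR, Y), (XR, B), (B, B), (B, Y'), (C, Y')]).Nodup := by
  have n5 : (poly [(B, Y'), (C, Y')]).Nodup := nodup_poly_pair _ _
  have n4 : (poly [(B, B), (B, Y'), (C, Y')]).Nodup := by
    refine nodup_poly_cons n5 (fun r hr hr' => ?_) (fun h => ?_)
    · rw [mem_seg_iff] at hr
      rcases mem_poly_csegs hr' with h | ⟨s, hs, hin⟩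
      · simp only [List.head?_cons, Option.some.injEq] at h; exact h.symm
      · simp only [csegs, List.drop_succ_cons, List.drop_zero, List.zip_cons_cons, List.zip_nil_right, List.mem_singleton] at hs
        subst hs; rw [inCseg_iff] at hin; simp only at hr hin; exact Prod.ext (by omega) (by omega)
    · rcases mem_poly_csegs h with h | ⟨s, hs, hin⟩
      · simp only [List.head?_cons, Option.some.injEq, Prod.mk.injEq] at h; omega
      · simp only [csegs, List.drop_succ_cons, List.drop_zero, List.zip_cons_cons, List.zip_nil_right, List.mem_singleton] at hs
        subst hs; rw [inCseg_iff] at hin; simp only at hin; omega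
  have n3 : (poly [(XR, B), (B, B), (B, Y'), (C, Y')]).Nodup := by
    refine nodup_poly_cons n4 (fun r hr hr' => ?_) (fun h => ?_)
    · rw [mem_seg_iff] at hr
      rcases mem_poly_csegs hr' with h | ⟨s, hs, hin⟩
      · simp only [List.head?_cons, Option.some.injEq] at h; exact h.symm
      · simp only [csegs, List.drop_succ_cons, List.drop_zero, List.zip_cons_cons, List.zip_nil_right, List.mem_cons,
          List.not_mem_nil, or_false] at hs
        rcases hs with rfl | rfl <;> rw [inCseg_iff] at hin <;> simp only at hr hin
        · exact Prod.ext (by omega) (by omega)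
        · exfalso; omega
    · rcases mem_poly_csegs h with h | ⟨s, hs, hin⟩
      · simp only [List.head?_cons, Option.some.injEq, Prod.mk.injEq] at h; omega
      · simp only [csegs, List.drop_succ_cons, List.drop_zero, List.zip_cons_cons, List.zip_nil_right, List.mem_cons,
          List.not_mem_nil, or_false] at hs
        rcases hs with rfl | rfl <;> rw [inCseg_iff] at hin <;> simp only at hin <;> omega
  have n2 : (poly [(XR, Y), (XR, B), (B, B), (B, Y'), (C, Y')]).Nodup := by
    refine nodup_poly_cons n3 (fun r hr hr' => ?_) (fun h => ?_)
    · rw [mem_seg_iff] at hr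
      rcases mem_poly_csegs hr' with h | ⟨s, hs, hin⟩
      · simp only [List.head?_cons, Option.some.injEq] at h; exact h.symm
      · simp only [csegs, List.drop_succ_cons, List.drop_zero, List.zip_cons_cons, List.zip_nil_right, List.mem_cons,
          List.not_mem_nil, or_false] at hs
        rcases hs with rfl | rfl | rfl <;> rw [inCseg_iff] at hin <;> simp only at hr hin
        · exact Prod.ext (by omega) (by omega)
        · exfalso; omega
        · exfalso; omega
    · rcases mem_poly_csegs h with h | ⟨s, hs, hin⟩
      · simp only [List.head?_cons, Option.some.injEq, Prod.mk.injEq] at h; omega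
      · simp only [csegs, List.drop_succ_cons, List.drop_zero, List.zip_cons_cons, List.zip_nil_right, List.mem_cons,
          List.not_mem_nil, or_false] at hs
        rcases hs with rfl | rfl | rfl <;> rw [inCseg_iff] at hin <;> simp only at hin <;> omega
  refine nodup_poly_cons n2 (fun r hr hr' => ?_) (fun h => ?_)
  · rw [mem_seg_iff] at hr
    rcases mem_poly_csegs hr' with h | ⟨s, hs, hin⟩
    · simp only [List.head?_cons, Option.some.injEq] at h; exact h.symm
    · simp only [csegs, List.drop_succ_cons, List.drop_zero, List.zip_cons_cons, List.zip_nil_right, List.mem_cons,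
        List.not_mem_nil, or_false] at hs
      rcases hs with rfl | rfl | rfl | rfl <;> rw [inCseg_iff] at hin <;> simp only at hr hin
      · exact Prod.ext (by omega) (by omega)
      · exfalso; omega
      · exfalso; omega
      · exfalso; omega
  · rcases mem_poly_csegs h with h | ⟨s, hs, hin⟩
    · simp only [List.head?_cons, Option.some.injEq, Prod.mk.injEq] at h; omega
    · simp only [csegs, List.drop_succ_cons, List.drop_zero, List.zip_cons_cons, List.zip_nil_right, List.mem_cons,
        List.not_mem_nil, or_false] at hs
      rcases hs with rfl | rfl | rfl | rfl <;> rw [inCseg_iff] at hin <;> simp only at hin <;> omega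

/-- **The return path of a row is self-avoiding.** [folklore] -/
theorem nodup_ret : (poly (retCorners ψ i)).Nodup := by
  rw [retCorners_eq]
  have hV : (V ψ - i : ℕ) = (V ψ - (i + 1) : ℕ) + 1 := by omega
  refine nodup_staircase ?_ ?_ ?_ ?_ ?_ <;> push_cast <;> omega

omit hi in
/-- **Return paths of different rows do not meet.** [folklore] -/
theorem ret_disjoint {i i' : ℕ} (hii : i < i') (hi' : i' < V ψ) {p : GridPoint} (hp : p ∈ poly (retCorners ψ i))
    (hp' : p ∈ poly (retCorners ψ i')) : False := by
  have h1 := ret_mem_cases (show i < V ψ by omega) hp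
  have h2 := ret_mem_cases hi' hp'
  simp only at h1 h2
  have e1 : ((V ψ - i : ℕ) : ℤ) = (V ψ : ℤ) - i := by rw [Nat.cast_sub (by omega)]
  have e2 : ((V ψ - (i + 1) : ℕ) : ℤ) = (V ψ : ℤ) - (i + 1) := by rw [Nat.cast_sub (by omega)]; push_cast; ring
  have e3 : ((V ψ - i' : ℕ) : ℤ) = (V ψ : ℤ) - i' := by rw [Nat.cast_sub (by omega)]
  have e4 : ((V ψ - (i' + 1) : ℕ) : ℤ) = (V ψ : ℤ) - (i' + 1) := by rw [Nat.cast_sub (by omega)]; push_cast; ring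
  push_cast at h1 h2
  rw [e1, e2] at h1
  rw [e3, e4] at h2
  have hii' : (i : ℤ) + 1 ≤ i' := by exact_mod_cast hii
  have hN' : (1 : ℤ) ≤ N ψ := by exact_mod_cast hN
  rcases h1 with ⟨a1, a2, a3⟩ | ⟨a1, a2, a3⟩ | ⟨a1, a2, a3⟩ | ⟨a1, a2, a3⟩ | ⟨a1, a2, a3⟩ <;>
    rcases h2 with ⟨b1, b2, b3⟩ | ⟨b1, b2, b3⟩ | ⟨b1, b2, b3⟩ | ⟨b1, b2, b3⟩ | ⟨b1, b2, b3⟩ <;>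
    omega

/-- **The east end of a return path**: the corner `Q` of the last cell of the row is a drawn vertex,
named `retStart`, drawn at the first corner. [folklore] -/
theorem retStart_spec (hw : WidthOK ψ) : ∃ o ∈ objs ψ, ∃ a ∈ o.1.verts, o.2 = (i, N ψ) ∧ a.1 = Ref.cell 0 0 2 4 ∧
    retStart ψ i = oname ψ o a.1 ∧
    gpos ψ (retStart ψ i) = (((4 * V ψ + 40 + 117 * N ψ : ℕ) : ℤ) + 107, ((4 * V ψ + 20 + 160 * (V ψ - i) : ℕ) : ℤ)) := by
  have ht : (i, N ψ) ∈ tcoords ψ := (mem_tcoords_iff ψ).2 (Or.inr ⟨hi.le, hN, le_rfl⟩)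
  have hb := bspecAt_tile (ψ := ψ) hi (jj := N ψ) hN
  have := retEnds_bundle
  simp only [List.all_eq_true, Bool.and_eq_true, Bool.or_eq_true, Bool.not_eq_true', List.any_eq_true,
    List.contains_iff_mem] at this
  obtain ⟨h1, -⟩ := this (bspecAt ψ i (N ψ)) (BSpec.mem_all _)
  rw [hb] at h1
  rcases h1 with h1 | ⟨κ, hκ, hmem⟩
  · simp [BSpec.isTile] at h1
  rw [← hb] at hκ
  have ho : ((κ, i, N ψ) : Obj) ∈ objs ψ := (mem_objs_iff ψ).2 ⟨ht, hκ⟩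
  refine ⟨(κ, i, N ψ), ho, _, hmem, rfl, rfl, ?_, ?_⟩
  · simp only [oname, gname_cell00, retStart, cellAt_nat]
    rw [if_neg (by omega), if_pos hi]
  · have hname : retStart ψ i = oname ψ (κ, i, N ψ) (Ref.cell 0 0 2 4) := by
      simp only [oname, gname_cell00, retStart, cellAt_nat]
      rw [if_neg (by omega), if_pos hi]
    rw [hname, gpos_own hw ho hmem]
    simp only [oanchor, anchor, shiftPt, Prod.mk.injEq]
    push_cast; constructor <;> ring

/-- **The west end of a return path**: the connector of the first cell of the next row is a drawn
vertex, named `retEnd`, drawn at the last corner. [folklore] -/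
theorem retEnd_spec (hw : WidthOK ψ) : ∃ o ∈ objs ψ, ∃ a ∈ o.1.verts, o.2 = (i + 1, 1) ∧ a.1 = Ref.cell 0 0 0 0 ∧
    retEnd ψ i = oname ψ o a.1 ∧
    gpos ψ (retEnd ψ i) = (((4 * V ψ + 40 + 117 * 1 : ℕ) : ℤ) + 15, ((4 * V ψ + 20 + 160 * (V ψ - (i + 1)) : ℕ) : ℤ)) := by
  have ht : (i + 1, 1) ∈ tcoords ψ := (mem_tcoords_iff ψ).2 (Or.inr ⟨by simp only; omega, le_rfl, hN⟩)
  have := retEnds_bundle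
  simp only [List.all_eq_true, Bool.and_eq_true, Bool.or_eq_true, Bool.not_eq_true', List.any_eq_true,
    List.contains_iff_mem] at this
  obtain ⟨-, h2⟩ := this (bspecAt ψ (i + 1) 1) (BSpec.mem_all _)
  have hk : cellAt ψ (((i + 1 : ℕ) : ℤ)) (((1 : ℕ) : ℤ)) 0 = tileCell ψ i (N ψ - 1) 2 + 1 := by
    rw [cellAt_nat]
    rw [if_neg one_ne_zero]
    split_ifs with hlt
    · unfold tileCell
      have : (i + 1) * N ψ = i * N ψ + N ψ := by ring
      omega
    · have hiV : i + 1 = V ψ := by omega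
      unfold clauseBead tileCell
      have : V ψ * N ψ = i * N ψ + N ψ := by rw [← hiV]; ring
      omega
  rcases tile_classes ht with ⟨h0, -, -⟩ | ⟨hlt, -, -, hb⟩ | ⟨heq, -, -, -, hb⟩
  · omega
  all_goals
    rw [hb] at h2
    rcases h2 with h2 | ⟨κ, hκ, hmem⟩
    · simp [BSpec.isTile, BSpec.isClause] at h2
    rw [← hb] at hκ
    have ho : ((κ, i + 1, 1) : Obj) ∈ objs ψ := (mem_objs_iff ψ).2 ⟨ht, hκ⟩
    have hname : retEnd ψ i = oname ψ (κ, i + 1, 1) (Ref.cell 0 0 0 0) := by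
      simp only [oname, gname_cell00, retEnd, add_zero]
      push_cast at hk ⊢; rw [hk]
    refine ⟨(κ, i + 1, 1), ho, _, hmem, rfl, rfl, hname, ?_⟩
    rw [hname, gpos_own hw ho hmem]
    simp only [oanchor, anchor, shiftPt, Prod.mk.injEq]
    push_cast; constructor <;> ring

end retGeometry

/-! ### The drawn edges -/

/-- The edges of the drawing: object edges, then return edges. [folklore] -/
theorem dedges_eq : (drawing ψ).edges = (objs ψ).flatMap (oedges ψ) ++ retEdges ψ := rfl

/-- Membership in the drawn edges. [folklore] -/
theorem mem_dedges_iff {d : SEdge ℕ} : d ∈ (drawing ψ).edges ↔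
    (∃ o ∈ objs ψ, ∃ e ∈ o.1.wedges, d = (oname ψ o e.1, oname ψ o e.2.1, (poly e.2.2).map (shiftPt (oanchor ψ o)))) ∨
    ∃ i < V ψ, d = (retStart ψ i, retEnd ψ i, poly (retCorners ψ i)) := by
  rw [dedges_eq, List.mem_append, List.mem_flatMap]
  simp only [mem_oedges_iff, retEdges, List.mem_map, List.mem_range]
  constructor
  · rintro (⟨o, ho, e, he, rfl⟩ | ⟨i, hi, rfl⟩)
    · exact Or.inl ⟨o, ho, e, he, rfl⟩
    · exact Or.inr ⟨i, hi, rfl⟩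
  · rintro (⟨o, ho, e, he, rfl⟩ | ⟨i, hi, rfl⟩)
    · exact Or.inl ⟨o, ho, e, he, rfl⟩
    · exact Or.inr ⟨i, hi, rfl⟩

/-- The position map of the drawing. [folklore] -/
@[simp] theorem dpos_eq : (drawing ψ).pos = gpos ψ := rfl

/-- The names of the two ends of a return path differ, and differ from the ends of other
return paths. [folklore] -/
theorem retStart_ne_retEnd (i i' : ℕ) : retStart ψ i ≠ retEnd ψ i' := by
  simp only [retStart, retEnd]; omega

/-- `retStart` is injective. [folklore] -/
theorem retStart_injective (hN : 0 < N ψ) {i i' : ℕ} (h : retStart ψ i = retStart ψ i') : i = i' := by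
  simp only [retStart, tileCell] at h
  have : i * N ψ = i' * N ψ := by omega
  exact Nat.eq_of_mul_eq_mul_right hN this

section valid

variable (hw : WidthOK ψ) (hN : 0 < N ψ)
include hw hN

omit hN in
/-- Distinct drawn vertices at distinct points. [folklore] -/
theorem dpos_inj {v w : ℕ} (hv : v ∈ (drawing ψ).verts) (hw' : w ∈ (drawing ψ).verts) (h : gpos ψ v = gpos ψ w) : v = w := by
  obtain ⟨o, ho, a, ha, rfl⟩ := mem_dverts_iff.1 hv
  obtain ⟨o', ho', a', ha', rfl⟩ := mem_dverts_iff.1 hw'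
  exact name_eq_of_pos_eq hw ho ho' ha ha' h

/-- The per-edge conditions of validity. [folklore] -/
theorem dedge_wf {d : SEdge ℕ} (hd : d ∈ (drawing ψ).edges) :
    d.1 ∈ (drawing ψ).verts ∧ d.2.1 ∈ (drawing ψ).verts ∧ d.1 ≠ d.2.1 ∧
    d.2.2.head? = some (gpos ψ d.1) ∧ d.2.2.getLast? = some (gpos ψ d.2.1) ∧ d.2.2.Nodup ∧ List.IsChain IsGridEdge d.2.2 := by
  rcases mem_dedges_iff.1 hd with ⟨o, ho, e, he, rfl⟩ | ⟨i, hi, rfl⟩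
  · exact oedge_wf hw hN ho he
  · obtain ⟨o₁, ho₁, a₁, ha₁, -, -, hn₁, hp₁⟩ := retStart_spec hN hi hw
    obtain ⟨o₂, ho₂, a₂, ha₂, -, -, hn₂, hp₂⟩ := retEnd_spec hN hi hw
    refine ⟨?_, ?_, retStart_ne_retEnd i i, ?_, ?_, nodup_ret hN hi, isChain_poly (retCorners ψ i)⟩
    · rw [hn₁]; exact mem_dverts_iff.2 ⟨o₁, ho₁, a₁, ha₁, rfl⟩
    · rw [hn₂]; exact mem_dverts_iff.2 ⟨o₂, ho₂, a₂, ha₂, rfl⟩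
    · simp only; rw [hp₁, head?_poly, retCorners_eq]; rfl
    · simp only; rw [hp₂, getLast?_poly, retCorners_eq]; rfl

/-- A drawn vertex on an edge is one of its ends. [folklore] -/
theorem dinterior {d : SEdge ℕ} (hd : d ∈ (drawing ψ).edges) {v : ℕ} (hv : v ∈ (drawing ψ).verts) (hpv : gpos ψ v ∈ d.2.2) :
    v = d.1 ∨ v = d.2.1 := by
  obtain ⟨o', ho', a', ha', rfl⟩ := mem_dverts_iff.1 hv
  rw [gpos_own hw ho' ha'] at hpv
  rcases mem_dedges_iff.1 hd with ⟨o, ho, e, he, rfl⟩ | ⟨i, hi, rfl⟩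
  · obtain ⟨q, hq, hq'⟩ := List.mem_map.1 hpv
    exact vertex_on_edge hw hN ho ho' he ha' hq hq'.symm
  · simp only at hpv ⊢
    have hloc : IsLocalPt o'.1 a'.2 :=
      Or.inl (List.mem_map.2 ⟨a', by rw [Kind.posTable]; exact List.mem_append_left _ ha', rfl⟩)
    obtain ⟨o₁, ho₁, a₁, ha₁, -, -, hn₁, hp₁⟩ := retStart_spec hN hi hw
    obtain ⟨o₂, ho₂, a₂, ha₂, -, -, hn₂, hp₂⟩ := retEnd_spec hN hi hw
    rcases object_pt_on_ret hw hN ho' hloc hi hpv with h | h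
    · left; rw [hn₁]
      refine name_eq_of_pos_eq hw ho' ho₁ ha' ha₁ ?_
      rw [gpos_own hw ho' ha', h, ← hp₁, hn₁]
    · right; rw [hn₂]
      refine name_eq_of_pos_eq hw ho' ho₂ ha' ha₂ ?_
      rw [gpos_own hw ho' ha', h, ← hp₂, hn₂]

/-- An object edge and a return edge do not have the same ends. [folklore] -/
theorem not_sameEnds_ret {o : Obj} (ho : o ∈ objs ψ) {e : Ref × Ref × List GridPoint} (he : e ∈ o.1.wedges) {i : ℕ} (hi : i < V ψ)
    {r₁ r₂ : Ref} (hr : (r₁ = e.1 ∧ r₂ = e.2.1) ∨ (r₁ = e.2.1 ∧ r₂ = e.1))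
    (h₁ : oname ψ o r₁ = retStart ψ i) (h₂ : oname ψ o r₂ = retEnd ψ i) : False := by
  obtain ⟨he1, he2, -⟩ := edgeWF_of_mem he
  have hr₁ : r₁ ∈ (o.1.posTable).map Prod.fst := by rcases hr with ⟨rfl, -⟩ | ⟨rfl, -⟩ <;> assumption
  have hr₂ : r₂ ∈ (o.1.posTable).map Prod.fst := by rcases hr with ⟨-, rfl⟩ | ⟨-, rfl⟩ <;> assumption
  obtain ⟨o₁, ho₁, a₁, ha₁, ht₁, hk₁, hn₁, -⟩ := retStart_spec hN hi hw
  obtain ⟨o₂, ho₂, a₂, ha₂, ht₂, hk₂, hn₂, -⟩ := retEnd_spec hN hi hw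
  have hcq := connQ_all o.1
  simp only [List.all_eq_true, Bool.and_eq_true] at hcq
  obtain ⟨hc1, hc2⟩ := hcq e he
  have hA₁ : absRef o.2.1 o.2.2 r₁ = absRef o₁.2.1 o₁.2.2 a₁.1 :=
    absRef_eq_of_oname_eq hw hN ho ho₁ hr₁
      (by rw [Kind.posTable, List.map_append]; exact List.mem_append_left _ (List.mem_map.2 ⟨a₁, ha₁, rfl⟩)) (h₁.trans hn₁)
  have hA₂ : absRef o.2.1 o.2.2 r₂ = absRef o₂.2.1 o₂.2.2 a₂.1 :=
    absRef_eq_of_oname_eq hw hN ho ho₂ hr₂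
      (by rw [Kind.posTable, List.map_append]; exact List.mem_append_left _ (List.mem_map.2 ⟨a₂, ha₂, rfl⟩)) (h₂.trans hn₂)
  rw [hk₁] at hA₁
  rw [hk₂] at hA₂
  obtain ⟨κ₁, i₁, j₁⟩ := o₁
  obtain ⟨κ₂, i₂, j₂⟩ := o₂
  simp only [Prod.mk.injEq] at ht₁ ht₂
  obtain ⟨rfl, rfl⟩ := ht₁
  obtain ⟨rfl, rfl⟩ := ht₂
  cases r₁ with
  | gad di dj f idx => simp [absRef] at hA₁
  | cell di dj c l =>
    cases r₂ with
    | gad di' dj' f idx => simp [absRef] at hA₂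
    | cell di' dj' c' l' =>
      simp only [absRef, Prod.mk.injEq, Sum.inl.injEq] at hA₁ hA₂
      obtain ⟨⟨hi₁, -⟩, rfl, rfl⟩ := hA₁
      obtain ⟨⟨hi₂, -⟩, rfl, rfl⟩ := hA₂
      push_cast at hi₁ hi₂
      rcases hr with ⟨h1, h2⟩ | ⟨h1, h2⟩
      · rw [← h1, ← h2] at hc2; simp [connQSameRowB] at hc2; omega
      · rw [← h1, ← h2] at hc1; simp [connQSameRowB] at hc1; omega

end valid

/-! ### No parallel edges, congestion-freeness, and the validity record -/

section valid2

variable (hw : WidthOK ψ) (hN : 0 < N ψ)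
include hw hN

omit hw hN in
/-- Two edge entries of the drawing, listed in order, are from distinct sources. We phrase the two
pairwise fields through this case analysis. [folklore] -/
theorem pairwise_dedges {R : SEdge ℕ → SEdge ℕ → Prop}
    (hoo : ∀ o₁ ∈ objs ψ, ∀ o₂ ∈ objs ψ, ∀ e₁ ∈ o₁.1.wedges, ∀ e₂ ∈ o₂.1.wedges, (o₁ ≠ o₂ ∨ e₁ ≠ e₂) →
      R (oname ψ o₁ e₁.1, oname ψ o₁ e₁.2.1, (poly e₁.2.2).map (shiftPt (oanchor ψ o₁)))
        (oname ψ o₂ e₂.1, oname ψ o₂ e₂.2.1, (poly e₂.2.2).map (shiftPt (oanchor ψ o₂))))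
    (hor : ∀ o ∈ objs ψ, ∀ e ∈ o.1.wedges, ∀ i < V ψ,
      R (oname ψ o e.1, oname ψ o e.2.1, (poly e.2.2).map (shiftPt (oanchor ψ o))) (retStart ψ i, retEnd ψ i, poly (retCorners ψ i)))
    (hrr : ∀ i < V ψ, ∀ i' < V ψ, i < i' →
      R (retStart ψ i, retEnd ψ i, poly (retCorners ψ i)) (retStart ψ i', retEnd ψ i', poly (retCorners ψ i'))) :
    (drawing ψ).edges.Pairwise R := by
  rw [dedges_eq, List.pairwise_append]
  refine ⟨?_, ?_, ?_⟩
  · -- object edges among themselves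
    rw [List.flatMap_def, List.pairwise_flatten]
    constructor
    · intro l hl
      obtain ⟨o, ho, rfl⟩ := List.mem_map.1 hl
      simp only [oedges]
      rw [List.pairwise_map]
      exact (wedges_nodup_all o.1).pairwise_of_forall_ne fun e₁ he₁ e₂ he₂ hne => hoo o ho o ho e₁ he₁ e₂ he₂ (Or.inr hne)
    · rw [List.pairwise_map]
      refine (nodup_objs (ψ := ψ)).pairwise_of_forall_ne fun o₁ ho₁ o₂ ho₂ hne => ?_
      intro x hx y hy
      obtain ⟨e₁, he₁, rfl⟩ := (mem_oedges_iff (ψ := ψ)).1 hx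
      obtain ⟨e₂, he₂, rfl⟩ := (mem_oedges_iff (ψ := ψ)).1 hy
      exact hoo o₁ ho₁ o₂ ho₂ e₁ he₁ e₂ he₂ (Or.inl hne)
  · -- return edges among themselves
    simp only [retEdges]
    rw [List.pairwise_map]
    exact List.pairwise_lt_range.imp_of_mem (fun {i i'} hi hi' h => hrr i (List.mem_range.1 hi) i' (List.mem_range.1 hi') h)
  · -- object edge before return edge
    intro x hx y hy
    obtain ⟨o, ho, hx⟩ := List.mem_flatMap.1 hx
    obtain ⟨e, he, rfl⟩ := (mem_oedges_iff (ψ := ψ)).1 hx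
    simp only [retEdges, List.mem_map, List.mem_range] at hy
    obtain ⟨i, hi, rfl⟩ := hy
    exact hor o ho e he i hi

/-- **No two drawn edges have the same ends.** [folklore] -/
theorem dsimple : (drawing ψ).edges.Pairwise fun e e' => ¬ SDrawing.SameEndsS e e' := by
  refine pairwise_dedges (fun o₁ ho₁ o₂ ho₂ e₁ he₁ e₂ he₂ hne h => ?_) (fun o ho e he i hi h => ?_) (fun i hi i' hi' hlt h => ?_)
  · rcases h with ⟨h1, h2⟩ | ⟨h1, h2⟩
    · exact not_sameEnds hw hN ho₁ ho₂ he₁ he₂ hne h1 h2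
    · exact not_sameEnds' hw hN ho₁ ho₂ he₁ he₂ hne h1 h2
  · rcases h with ⟨h1, h2⟩ | ⟨h1, h2⟩
    · exact not_sameEnds_ret hw hN ho he hi (Or.inl ⟨rfl, rfl⟩) h1 h2
    · exact not_sameEnds_ret hw hN ho he hi (Or.inr ⟨rfl, rfl⟩) h2 h1
  · rcases h with ⟨h1, -⟩ | ⟨h1, -⟩
    · exact absurd (retStart_injective hN h1) (by omega)
    · exact retStart_ne_retEnd i i' h1

/-- **Congestion-free: a point common to two drawn edges is a vertex position.** [folklore] -/
theorem ddisjoint : (drawing ψ).edges.Pairwise fun e e' => ∀ p ∈ e.2.2, p ∈ e'.2.2 → ∃ v ∈ (drawing ψ).verts, (drawing ψ).pos v = p := by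
  refine pairwise_dedges (fun o₁ ho₁ o₂ ho₂ e₁ he₁ e₂ he₂ hne p hp hp' => ?_) (fun o ho e he i hi p hp hp' => ?_)
    (fun i hi i' hi' hlt p hp hp' => ?_)
  · obtain ⟨q, hq, rfl⟩ := List.mem_map.1 hp
    obtain ⟨q', hq', hqq⟩ := List.mem_map.1 hp'
    exact common_point_is_vertex hw hN ho₁ ho₂ he₁ he₂ hne hq hq' hqq.symm
  · obtain ⟨q, hq, rfl⟩ := List.mem_map.1 hp
    simp only at hp'
    have hloc : IsLocalPt o.1 q := Or.inr ⟨e, he, hq⟩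
    obtain ⟨o₁, ho₁, a₁, ha₁, -, -, hn₁, hp₁⟩ := retStart_spec hN hi hw
    obtain ⟨o₂, ho₂, a₂, ha₂, -, -, hn₂, hp₂⟩ := retEnd_spec hN hi hw
    rcases object_pt_on_ret hw hN ho hloc hi hp' with h | h
    · exact ⟨retStart ψ i, by rw [hn₁]; exact mem_dverts_iff.2 ⟨o₁, ho₁, a₁, ha₁, rfl⟩, by rw [dpos_eq, hp₁, h]⟩
    · exact ⟨retEnd ψ i, by rw [hn₂]; exact mem_dverts_iff.2 ⟨o₂, ho₂, a₂, ha₂, rfl⟩, by rw [dpos_eq, hp₂, h]⟩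
  · exact (ret_disjoint hN hlt hi' hp hp').elim

/-- **The drawing is valid**, given the degree bound. [folklore] -/
theorem isValid_of_degree (hdeg : ∀ v ∈ (drawing ψ).verts, (drawing ψ).degree v ≤ 3) : (drawing ψ).IsValid where
  nodup_verts := nodup_verts hw
  pos_inj := fun _ hv _ hw' h => dpos_inj hw hv hw' h
  fst_mem := fun _ hd => (dedge_wf hw hN hd).1
  snd_mem := fun _ hd => (dedge_wf hw hN hd).2.1
  fst_ne_snd := fun _ hd => (dedge_wf hw hN hd).2.2.1
  head?_eq := fun _ hd => (dedge_wf hw hN hd).2.2.2.1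
  getLast?_eq := fun _ hd => (dedge_wf hw hN hd).2.2.2.2.1
  nodup_path := fun _ hd => (dedge_wf hw hN hd).2.2.2.2.2.1
  isChain_path := fun _ hd => (dedge_wf hw hN hd).2.2.2.2.2.2
  interior := fun _ hd _ hv hpv => dinterior hw hN hd hv hpv
  simple := dsimple hw hN
  disjoint := ddisjoint hw hN
  degree_le := hdeg

end valid2

/-! ### Maximum degree three -/

/-- Counting a disjunction. [folklore] -/
theorem countP_or_le {β : Type*} (l : List β) (p q : β → Bool) :
    l.countP (fun x => p x || q x) ≤ l.countP p + l.countP q := by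
  induction l with
  | nil => simp
  | cons x l ih =>
    simp only [List.countP_cons]
    cases p x <;> cases q x <;> simp <;> omega

/-- A guarded maximum over a list dominates every guarded entry. [folklore] -/
theorem le_foldr_max {β : Type*} (L : List β) (P : β → Bool) (f : β → ℕ) {b : β} (hb : b ∈ L) (hP : P b = true) :
    f b ≤ L.foldr (fun b' m => if P b' then max (f b') m else m) 0 := by
  induction L with
  | nil => cases hb
  | cons x L ih =>
    simp only [List.foldr_cons]
    rcases List.mem_cons.1 hb with rfl | hb
    · rw [if_pos hP]; exact le_max_left _ _
    · have := ih hb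
      split_ifs
      · exact this.trans (le_max_right _ _)
      · exact this

/-- `nbrMax` dominates the count of every realisable neighbour bundle. [folklore] -/
theorem le_nbrMax {b b' : BSpec} (hb' : b' ∈ BSpec.all) {Δ : ℤ × ℤ} (hr : realizable b b' Δ = true) (r : Ref) :
    b'.bundleCnt (Kind.reRef (-Δ.1, -Δ.2) r) ≤ b.nbrMax Δ r :=
  le_foldr_max BSpec.all (fun b' => realizable b b' Δ) (fun b' => b'.bundleCnt (Kind.reRef (-Δ.1, -Δ.2) r)) hb' hr

/-- Re-anchoring by the zero offset. [folklore] -/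
theorem reRef_zero (r : Ref) : Kind.reRef (0, 0) r = r := by
  cases r <;> simp [Kind.reRef]

/-- The offset of a re-anchored reference. [folklore] -/
theorem offset_reRef (Δ : ℤ × ℤ) (r : Ref) : (Kind.reRef Δ r).offset = (r.offset.1 + Δ.1, r.offset.2 + Δ.2) := by
  cases r <;> simp [Kind.reRef, Ref.offset]

/-- The cheap end count is the end count. [folklore] -/
theorem endCnt'_eq (κ : Kind) (r : Ref) : κ.endCnt' r = κ.endCnt r := by
  unfold Kind.endCnt'
  split_ifs with h
  · rfl
  · symm
    rw [Kind.endCnt, List.count_eq_zero]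
    intro hr
    apply h
    simp only [Bool.or_eq_true, decide_eq_true_eq, List.any_eq_true, beq_iff_eq]
    -- an end reference is listed: own (offset zero) or foreign
    have hlisted : r ∈ (κ.posTable).map Prod.fst := by
      simp only [Kind.endRefs, List.mem_append, List.mem_map] at hr
      rcases hr with ⟨e, he, rfl⟩ | ⟨e, he, rfl⟩
      · exact (edgeWF_of_mem he).1
      · exact (edgeWF_of_mem he).2.1
    rw [Kind.posTable, List.map_append, List.mem_append] at hlisted
    rcases hlisted with h1 | h1
    · obtain ⟨a, ha, rfl⟩ := List.mem_map.1 h1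
      exact Or.inl (own_offset ha).1
    · obtain ⟨q, hq, rfl⟩ := List.mem_map.1 h1
      exact Or.inr ⟨q, hq, rfl⟩

/-- **The edges of one object at a given own vertex of another** are at most the end count of the
re-anchored reference. [folklore] -/
theorem countP_oedges_le (hw : WidthOK ψ) (hN : 0 < N ψ) {o o' : Obj} (ho : o ∈ objs ψ) (ho' : o' ∈ objs ψ)
    {a : Ref × GridPoint} (ha : a ∈ o.1.verts) :
    (oedges ψ o').countP (fun d => decide (d.1 = oname ψ o a.1 ∨ d.2.1 = oname ψ o a.1)) ≤
      o'.1.endCnt (Kind.reRef ((o.2.1 : ℤ) - o'.2.1, (o.2.2 : ℤ) - o'.2.2) a.1) := by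
  have ha' : a.1 ∈ (o.1.posTable).map Prod.fst := by
    rw [Kind.posTable, List.map_append]; exact List.mem_append_left _ (List.mem_map.2 ⟨a, ha, rfl⟩)
  set r₀ := Kind.reRef ((o.2.1 : ℤ) - o'.2.1, (o.2.2 : ℤ) - o'.2.2) a.1 with hr₀
  simp only [oedges, List.countP_map]
  calc (o'.1.wedges).countP ((fun d => decide (d.1 = oname ψ o a.1 ∨ d.2.1 = oname ψ o a.1)) ∘ fun e =>
          (oname ψ o' e.1, oname ψ o' e.2.1, (poly e.2.2).map (shiftPt (oanchor ψ o'))))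
      ≤ (o'.1.wedges).countP (fun e => decide (e.1 = r₀) || decide (e.2.1 = r₀)) := by
        refine List.countP_mono_left fun e he h => ?_
        simp only [Function.comp, decide_eq_true_eq] at h
        simp only [Bool.or_eq_true, decide_eq_true_eq]
        obtain ⟨he1, he2, -⟩ := edgeWF_of_mem he
        rcases h with h | h
        · exact Or.inl (eq_reRef_of_oname_eq hw hN ho' ho he1 ha' h)
        · exact Or.inr (eq_reRef_of_oname_eq hw hN ho' ho he2 ha' h)
    _ ≤ (o'.1.wedges).countP (fun e => decide (e.1 = r₀)) + (o'.1.wedges).countP (fun e => decide (e.2.1 = r₀)) :=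
        countP_or_le _ _ _
    _ = o'.1.endCnt r₀ := by
        rw [Kind.endCnt, Kind.endRefs, List.count_append, List.count_eq_countP, List.count_eq_countP, List.countP_map,
          List.countP_map]
        congr 1

/-- **Support of the counts**: an object whose edges reach an own vertex of the object at tile `t`
sits at `t` itself or at one of the neighbour offsets of the vertex class. [folklore] -/
theorem delta_mem_of_endCnt'_ne_zero {κ' : Kind} {a : Ref × GridPoint} {κ : Kind} (ha : a ∈ κ.verts) {i jj i' jj' : ℕ}
    (h : κ'.endCnt' (Kind.reRef ((i : ℤ) - i', (jj : ℤ) - jj') a.1) ≠ 0) :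
    ((i' : ℤ) - i, (jj' : ℤ) - jj) ∈ ((0 : ℤ), (0 : ℤ)) :: a.1.nbrDeltas := by
  unfold Kind.endCnt' at h
  split_ifs at h with hc
  · simp only [Bool.or_eq_true, decide_eq_true_eq, List.any_eq_true, beq_iff_eq] at hc
    have hown := (own_offset ha).1
    rcases hc with hc | ⟨q, hq, hqr⟩
    · rw [offset_reRef, hown] at hc
      simp only [Prod.mk.injEq, zero_add] at hc
      exact List.mem_cons.2 (Or.inl (Prod.ext (by simp only; omega) (by simp only; omega)))
    · have hcl := phantomClass_all κ'
      simp only [List.all_eq_true] at hcl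
      have hcl := hcl q hq
      rw [hqr] at hcl
      obtain ⟨r, p⟩ := a
      cases r with
      | gad di dj f idx => simp [Kind.reRef] at hcl
      | cell di dj c l =>
        simp only [Ref.offset, Prod.mk.injEq] at hown
        obtain ⟨rfl, rfl⟩ := hown
        simp only [Kind.reRef, zero_add, Bool.or_eq_true, decide_eq_true_eq, Prod.mk.injEq, neg_sub] at hcl ⊢
        rcases hcl with ⟨h1, h2⟩ | hcl
        · exact List.mem_cons.2 (Or.inl (Prod.ext (by simp only; omega) (by simp only; omega)))
        · exact List.mem_cons_of_mem _ hcl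
  · exact absurd rfl h

/-- The neighbour offsets are small and nonzero, and listed once. [folklore] -/
theorem nbrDeltas_props (r : Ref) : (∀ Δ ∈ r.nbrDeltas, (Δ.1 ≤ 1 ∧ -1 ≤ Δ.1) ∧ (Δ.2 ≤ 2 ∧ -2 ≤ Δ.2) ∧ Δ ≠ (0, 0)) ∧
    r.nbrDeltas.Nodup ∧ ((0 : ℤ), (0 : ℤ)) ∉ r.nbrDeltas := by
  rcases r with ⟨di, dj, c, l⟩ | ⟨di, dj, f, idx⟩
  · simp only [Ref.nbrDeltas]
    split_ifs <;> decide
  · simp [Ref.nbrDeltas]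

/-- Summing over a flat map. [folklore] -/
theorem sum_map_flatMap {β γ : Type*} (l : List β) (f : β → List γ) (h : γ → ℕ) :
    ((l.flatMap f).map h).sum = (l.map fun x => ((f x).map h).sum).sum := by
  induction l with
  | nil => simp
  | cons x l ih => simp [List.flatMap_cons, List.sum_append, ih]

section degree

variable (hw : WidthOK ψ) (hN : 0 < N ψ)
include hw hN

/-- **The object edges at an own vertex**: own bundle, plus the worst realisable neighbours. [folklore] -/
theorem countP_objs_le {κ : Kind} {i jj : ℕ} (ho : ((κ, i, jj) : Obj) ∈ objs ψ) {a : Ref × GridPoint} (ha : a ∈ κ.verts) :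
    ((objs ψ).flatMap (oedges ψ)).countP (fun d => decide (d.1 = oname ψ (κ, i, jj) a.1 ∨ d.2.1 = oname ψ (κ, i, jj) a.1)) ≤
      (bspecAt ψ i jj).bundleCnt a.1 + ((a.1.nbrDeltas.map fun Δ => (bspecAt ψ i jj).nbrMax Δ a.1).sum) := by
  obtain ⟨ht, hb⟩ := (mem_objs_iff ψ).1 ho
  simp only at ht hb
  -- per object, then per tile
  set g : ℕ × ℕ → ℕ := fun t' => (bspecAt ψ t'.1 t'.2).bundleCnt (Kind.reRef ((i : ℤ) - t'.1, (jj : ℤ) - t'.2) a.1) with hg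
  have step1 : ((objs ψ).flatMap (oedges ψ)).countP
      (fun d => decide (d.1 = oname ψ (κ, i, jj) a.1 ∨ d.2.1 = oname ψ (κ, i, jj) a.1)) ≤ ((tcoords ψ).map g).sum := by
    rw [List.countP_flatMap]
    calc ((objs ψ).map fun o' => (oedges ψ o').countP _).sum
        ≤ ((objs ψ).map fun o' => o'.1.endCnt' (Kind.reRef ((i : ℤ) - o'.2.1, (jj : ℤ) - o'.2.2) a.1)).sum := by
          refine List.sum_le_sum fun o' ho' => ?_
          rw [endCnt'_eq]
          exact countP_oedges_le hw hN ho ho' ha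
      _ = ((tcoords ψ).map g).sum := by
          simp only [objs, hg, BSpec.bundleCnt]
          rw [sum_map_flatMap]
          congr 1
          refine List.map_congr_left fun t' _ => ?_
          rw [List.map_map]
          rfl
  refine step1.trans ?_
  -- support in `t + D`
  set D : List (ℤ × ℤ) := ((0 : ℤ), (0 : ℤ)) :: a.1.nbrDeltas with hD
  set δ : ℕ × ℕ → ℤ × ℤ := fun t' => ((t'.1 : ℤ) - i, (t'.2 : ℤ) - jj) with hδ
  obtain ⟨hsmall, hDnd, h0⟩ := nbrDeltas_props a.1
  have hDnodup : D.Nodup := List.nodup_cons.2 ⟨h0, hDnd⟩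
  have hsupp : ∀ t' ∈ tcoords ψ, g t' ≠ 0 → δ t' ∈ D := by
    intro t' _ hne
    simp only [hg, BSpec.bundleCnt] at hne
    obtain ⟨x, hx, hx0⟩ := List.exists_mem_ne_zero_of_sum_ne_zero hne
    obtain ⟨κ', -, rfl⟩ := List.mem_map.1 hx
    exact delta_mem_of_endCnt'_ne_zero ha hx0
  -- to finite sets
  rw [← List.sum_toFinset _ (nodup_tcoords (ψ := ψ))]
  have hfib : ∑ t' ∈ (tcoords ψ).toFinset, g t' = ∑ t' ∈ (tcoords ψ).toFinset with δ t' ∈ D.toFinset, g t' := by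
    rw [Finset.sum_filter]
    refine Finset.sum_congr rfl fun t' ht' => ?_
    split_ifs with hmem
    · rfl
    · by_contra hne
      exact hmem (List.mem_toFinset.2 (hsupp t' (List.mem_toFinset.1 ht') hne))
  rw [hfib, ← Finset.sum_fiberwise_of_maps_to (s := (tcoords ψ).toFinset.filter fun t' => δ t' ∈ D.toFinset)
    (t := D.toFinset) (g := δ) (fun t' ht' => (Finset.mem_filter.1 ht').2)]
  -- each fibre has at most one tile
  have hfibre : ∀ Δ ∈ D.toFinset, ∑ t' ∈ ((tcoords ψ).toFinset.filter fun t' => δ t' ∈ D.toFinset) with δ t' = Δ, g t' ≤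
      (if Δ = (0, 0) then (bspecAt ψ i jj).bundleCnt a.1 else (bspecAt ψ i jj).nbrMax Δ a.1) := by
    intro Δ hΔ
    by_cases hex : ∃ t' ∈ tcoords ψ, δ t' = Δ
    · obtain ⟨t₀, ht₀, hδ₀⟩ := hex
      have hset : (((tcoords ψ).toFinset.filter fun t' => δ t' ∈ D.toFinset).filter fun t' => δ t' = Δ) = {t₀} := by
        ext t'
        simp only [Finset.mem_filter, List.mem_toFinset, Finset.mem_singleton]
        constructor
        · rintro ⟨⟨-, -⟩, h⟩
          have : δ t' = δ t₀ := h.trans hδ₀.symm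
          simp only [hδ, Prod.mk.injEq] at this
          exact Prod.ext (by omega) (by omega)
        · rintro rfl
          exact ⟨⟨ht₀, by rw [hδ₀]; exact List.mem_toFinset.1 hΔ⟩, hδ₀⟩
      rw [hset, Finset.sum_singleton]
      split_ifs with hz
      · -- the own tile
        subst hz
        have : t₀ = (i, jj) := by
          simp only [hδ, Prod.mk.injEq] at hδ₀; exact Prod.ext (by omega) (by omega)
        subst this
        simp only [hg, sub_self, reRef_zero]; exact le_rfl
      · -- a neighbour
        have hmem : Δ ∈ a.1.nbrDeltas := by
          have := List.mem_toFinset.1 hΔ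
          rw [hD, List.mem_cons] at this
          exact this.resolve_left hz
        obtain ⟨h1, h2, -⟩ := hsmall Δ hmem
        obtain ⟨i₀, jj₀⟩ := t₀
        obtain ⟨Δ₁, Δ₂⟩ := Δ
        simp only [hδ, Prod.mk.injEq] at hδ₀
        obtain ⟨hδ₁, hδ₂⟩ := hδ₀
        have hreal : realizable (bspecAt ψ i jj) (bspecAt ψ i₀ jj₀) (Δ₁, Δ₂) = true :=
          realizable_bspecAt hw ht ht₀ hδ₁.symm hδ₂.symm h1 h2
        have := le_nbrMax (BSpec.mem_all _) hreal a.1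
        simp only [hg]
        convert this using 3
        simp only [Prod.mk.injEq]; constructor <;> omega
    · have hset : (((tcoords ψ).toFinset.filter fun t' => δ t' ∈ D.toFinset).filter fun t' => δ t' = Δ) = ∅ := by
        ext t'
        simp only [Finset.mem_filter, List.mem_toFinset, Finset.notMem_empty, iff_false, not_and]
        intro h hh
        exact hex ⟨t', h.1, hh⟩
      rw [hset, Finset.sum_empty]
      exact Nat.zero_le _
  refine (Finset.sum_le_sum hfibre).trans ?_
  rw [List.sum_toFinset _ hDnodup, hD, List.map_cons, List.sum_cons, if_pos rfl]
  refine Nat.add_le_add_left (le_of_eq ?_) _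
  congr 1
  refine List.map_congr_left fun Δ hΔ => ?_
  rw [if_neg (hsmall Δ hΔ).2.2]

/-- **The return edges at an own vertex.** [folklore] -/
theorem countP_ret_le {κ : Kind} {i jj : ℕ} (ho : ((κ, i, jj) : Obj) ∈ objs ψ) {a : Ref × GridPoint} (ha : a ∈ κ.verts) :
    (retEdges ψ).countP (fun d => decide (d.1 = oname ψ (κ, i, jj) a.1 ∨ d.2.1 = oname ψ (κ, i, jj) a.1)) ≤
      (bspecAt ψ i jj).retCnt a.1 := by
  simp only [retEdges, List.countP_map]
  have hsplit : (List.range (V ψ)).countP ((fun d => decide (d.1 = oname ψ (κ, i, jj) a.1 ∨ d.2.1 = oname ψ (κ, i, jj) a.1)) ∘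
        fun i => (retStart ψ i, retEnd ψ i, poly (retCorners ψ i))) ≤
      (List.range (V ψ)).countP (fun x => decide (retStart ψ x = oname ψ (κ, i, jj) a.1)) +
        (List.range (V ψ)).countP (fun x => decide (retEnd ψ x = oname ψ (κ, i, jj) a.1)) := by
    refine (le_of_eq ?_).trans (countP_or_le _ (fun x => decide (retStart ψ x = oname ψ (κ, i, jj) a.1))
      (fun x => decide (retEnd ψ x = oname ψ (κ, i, jj) a.1)))
    exact List.countP_congr fun x _ => by simp
  refine hsplit.trans (Nat.add_le_add ?_ ?_)
  · -- `retStart i' = v`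
    by_cases hex : ∃ i' < V ψ, retStart ψ i' = oname ψ (κ, i, jj) a.1
    · obtain ⟨i', hi', hv⟩ := hex
      obtain ⟨o₁, ho₁, a₁, ha₁, ht₁, hk₁, hn₁, -⟩ := retStart_spec hN hi' hw
      obtain ⟨rfl, hak⟩ := oname_inj hw ho ho₁ ha ha₁ (hv.symm.trans hn₁)
      simp only [Prod.mk.injEq] at ht₁
      obtain ⟨rfl, rfl⟩ := ht₁
      calc (List.range (V ψ)).countP (fun x => decide (retStart ψ x = oname ψ (κ, i, N ψ) a.1))
          ≤ (List.range (V ψ)).countP (fun x => x == i) := by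
            refine List.countP_mono_left fun x _ hx => ?_
            simp only [decide_eq_true_eq] at hx
            simp only [beq_iff_eq]
            exact retStart_injective hN (hx.trans hv.symm)
        _ = List.count i (List.range (V ψ)) := rfl
        _ ≤ 1 := List.nodup_iff_count_le_one.1 List.nodup_range i
        _ ≤ _ := by
            rw [hak, hk₁, bspecAt_tile hi' hN]
            simp
    · rw [List.countP_eq_zero.2]
      · exact Nat.zero_le _
      · intro x hx h
        simp only [decide_eq_true_eq] at h
        exact hex ⟨x, List.mem_range.1 hx, h⟩
  · -- `retEnd i' = v`
    by_cases hex : ∃ i' < V ψ, retEnd ψ i' = oname ψ (κ, i, jj) a.1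
    · obtain ⟨i', hi', hv⟩ := hex
      obtain ⟨o₂, ho₂, a₂, ha₂, ht₂, hk₂, hn₂, -⟩ := retEnd_spec hN hi' hw
      obtain ⟨rfl, hak⟩ := oname_inj hw ho ho₂ ha ha₂ (hv.symm.trans hn₂)
      simp only [Prod.mk.injEq] at ht₂
      obtain ⟨rfl, rfl⟩ := ht₂
      calc (List.range (V ψ)).countP (fun x => decide (retEnd ψ x = oname ψ (κ, i' + 1, 1) a.1))
          ≤ (List.range (V ψ)).countP (fun x => x == i') := by
            refine List.countP_mono_left fun x _ hx => ?_
            simp only [decide_eq_true_eq] at hx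
            simp only [beq_iff_eq]
            have := hx.trans hv.symm
            simp only [retEnd] at this
            have h17 : tileCell ψ x (N ψ - 1) 2 = tileCell ψ i' (N ψ - 1) 2 := by omega
            simp only [tileCell] at h17
            exact Nat.eq_of_mul_eq_mul_right hN (by omega)
        _ = List.count i' (List.range (V ψ)) := rfl
        _ ≤ 1 := List.nodup_iff_count_le_one.1 List.nodup_range i'
        _ ≤ _ := by
            rw [hak, hk₂]
            rcases Nat.lt_or_ge (i' + 1) (V ψ) with hlt | hge
            · rw [bspecAt_tile hlt le_rfl]; simp
            · have : i' + 1 = V ψ := by omega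
              rw [this, bspecAt_clause le_rfl]; simp
    · rw [List.countP_eq_zero.2]
      · exact Nat.zero_le _
      · intro x hx h
        simp only [decide_eq_true_eq] at h
        exact hex ⟨x, List.mem_range.1 hx, h⟩

/-- **Maximum degree three.** [folklore] -/
theorem degree_le_three {v : ℕ} (hv : v ∈ (drawing ψ).verts) : (drawing ψ).degree v ≤ 3 := by
  obtain ⟨o, ho, a, ha, rfl⟩ := mem_dverts_iff.1 hv
  obtain ⟨κ, i, jj⟩ := o
  obtain ⟨-, hb⟩ := (mem_objs_iff ψ).1 ho
  simp only at hb ha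
  have hdeg := degree_bundle
  simp only [List.all_eq_true, BSpec.degOKB, decide_eq_true_eq] at hdeg
  have hB := hdeg (bspecAt ψ i jj) (BSpec.mem_all _) κ hb a ha
  unfold SDrawing.degree
  rw [dedges_eq, List.countP_append]
  have h1 := countP_objs_le hw hN ho ha
  have h2 := countP_ret_le hw hN ho ha
  omega

/-- **The drawing of `ψ` is valid.** [folklore] -/
theorem isValid_drawing : (drawing ψ).IsValid :=
  isValid_of_degree hw hN fun _ hv => degree_le_three hw hN hv

end degree

end Literature.Barriers.CriticalPhenomena.GridSAW.FormulaDrawing
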